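import Literature.NumberTheory.LFunctions.ZeroDensityNearOne
import Literature.NumberTheory.LFunctions.ZeroDensityNearOneDetection
import Literature.Computability.Cryptography.HallgrenClassGroupDivisorSums
import HarnessLib

/-!
# The zero-density estimate near `σ = 1` holds: `N(σ, T) ≤ T^{B(1−σ)^{3/2}} (log T)^C`

NOT RH-BEARING (D-0040; bears_on LADDER-RH §4 HELD row `DensityLadder`, stmt-19600): a density
theorem counts zeros off the line, it never empties the strip (Barrier `LindelofBacklund`);
corpus theorems are RH-FREE literature and nothing in this file is worded as progress toward RH.

Topic `NumberTheory/LFunctions`, family RH, statement **rh.S12**; corpus C4 (Guth–Maynard §13.2),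
work package WP-D2b. This file DISCHARGES the interface
`Literature.NumberTheory.LFunctions.NearOneZeroDensity` of `ZeroDensityNearOne.lean`
(`∃ B C T₀, N(σ, T) ≤ T^{B(1−σ)^{3/2}} (log T)^C` for `T ≥ T₀`, `1/2 ≤ σ ≤ 1`; the shape of
Ivić 1985 Thm. 11.3 (11.33) / Montgomery 1971 Thm. 12.3–Cor. 12.5 with unspecified constants):
`nearOneZeroDensity_holds`.

## The proof followed (Ivić 1985, §11.2 and §11.4, proof of Theorem 11.3, with `k = 3`)

Write `η = 1 − σ` and take the auxiliary line `α = 1 − 3η` (Ivić takes `α = 5σ − 4`, i.e.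
`k = 5`, to optimise exponents; any `k > 2` gives the shape `T^{B η^{3/2}}`, and we do not track
constants). Montgomery's zero-detection method (Ivić (11.4)–(11.10)) with the Riesz kernel of
`ZetaZeroDetection.lean`, the line of integration moved to `Re = α`
(`NearOneDetect.zeroDetection_norm_ineq_line`, Ivić (11.45)): with
`X = T^{12Bη^{1/2}} (log T)^{12/η}` and `Y = T^{24Bη^{1/2}} (log T)^{21/η}` and the tree's
Richert-type bound `|ζ(α+it)| ≤ A|t|^{B(1−α)^{3/2}} log|t|` (`exists_richertTypeBound_one`, so that
`M(α, 3T) ≤ 2A T^{12Bη^{3/2}} log T`), Class II is EMPTY (`NearOneDetect.classOne_of_sup_line`: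
`Y^{σ−α} = Y^{2η}` beats `M(α,3T) X^{1−α}/(1−α) = M(α,3T) X^{3η}/(3η)`; Ivić (11.51)); the Class-I
zeros are counted block by block by Halász's lemma (`HalaszTuranLH.halasz_block_count`) with the
Halász–Montgomery kernel moved to the line `α` (`NearOneDetect.norm_smoothedKernel_le_line`: the
term `M^{1+α−2σ} M(α, 3T)` of Ivić (11.46)), the absorption `X^{2σ−1−α} = X^{η} ≫ M(α,3T) log⁵`
being Ivić's (11.48); the coefficient sums are bounded by `∑_{n≤x} d(n)² ≤ x(1 + log x)³`
(`Hallgren2005.sum_card_divisors_sq_le`). This gives `≪ J³ Y^{2η} log³ ≪ T^{48Bη^{3/2}}(log T)^{54}`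
well-spaced zeros per dyadic block `U < γ ≤ 2U`, `γ₀ ≤ U ≤ T` (the powers `(log T)^{c/η}` inside
`X, Y` cancel under `^η`), hence the bound for `N(σ, T)` by the unit-window count and dyadic
summation; heights below `γ₀ = T^{O(η^{3/2})}(log T)^{O(1)}` and the ranges `η > 1/12`,
`η < 1/log T` are covered by the trivial bound `N(σ, T) ≪ T log T` and by monotonicity in `σ`.
No zero-free region is used.

Relation to `ZeroDensityNearOneTools.lean` (landed concurrently, p420450): its
`ZeroDensity.count_dyadic_le_of_local` and `ZeroDensity.sum_norm_sq_rpow_le_of_norm_le_divisors` are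
the same two elementary steps as `count_dyadic_le_at` and `sum_norm_coeffB_sq_le_log` below (written
independently the same night); this file is kept self-contained (it does not import the Tools file),
and its assembly (`count_main`) is NOT the `U`-uniform one of
`ZeroDensity.nearOneZeroDensity_of_wellSpaced`: here the parameters `X, Y` are functions of `T`, the
well-spaced bound holds only for `γ₀(σ, T) ≤ U ≤ T`, and the heights below `γ₀` are counted
trivially.
TODO(dedup): a maintenance pass may replace Parts B1/B3 by the Tools lemmas.

## Main results (all PROVED; no definition of a notion, no named fact)

* `NearOneDensity.sum_norm_coeffB_sq_le_log` — `∑_{M<n≤2M} |b(n)|² n^{−2σ} ≤ 2M^{1−2σ}(1+log 2M)³`.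
* `NearOneDensity.classOne_count_line` — the Class-I count with the kernel at line `α`.
* `NearOneDensity.count_dyadic_le_at` — `N(σ,2U) − N(σ,U) ≤ 2W · C_w log(2U+3)` from a
  well-spaced bound `W` at the single height `U` (the tree's `ZeroDensity.count_dyadic_le` asks
  for the bound at every `U`).
* `NearOneDensity.sup_bound_line` — `M(1 − 3η, 3T) ≤ 2A T^{12Bη^{3/2}} log T + log T + 4K`.
* `NearOneDensity.wellSpaced_le` — the well-spaced count for `1/log T ≤ η ≤ 1/12`, `γ₀ ≤ U ≤ T`.
* `NearOneDensity.count_main` — `N(1 − η, T) ≤ C_m T^{48Bη^{3/2}} (log T)^{56}` for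
  `1/log T ≤ η ≤ 1/12` (dyadic summation, trivial count below `γ₀`).
* `Literature.NumberTheory.LFunctions.nearOneZeroDensity_holds : NearOneZeroDensity` (with
  `B_final = 48B + 288`, `C_final = 57`, `B` the exponent constant of
  `exists_richertTypeBound_one`).

## References

* A. Ivić, *The Riemann Zeta-Function* (1985), §11.2 (11.4)–(11.12), §11.4 Theorem 11.3 and its
  proof (11.44)–(11.53), pp. 269–281 (held copy, chunks p0207–p0216). [key `Ivic1985`]
* H. L. Montgomery, *Topics in Multiplicative Number Theory*, LNM 227 (1971), Thm. 12.3,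
  Cor. 12.5. [key `Montgomery1971`]
* E. C. Titchmarsh, *The Theory of the Riemann Zeta-Function*, 2nd ed. (1986), §9.28 (Halász's
  lemma). [key `Titchmarsh1986`]
-/

noncomputable section

open Complex Filter Topology Set MeasureTheory Finset
open scoped Real

namespace Literature.NumberTheory.LFunctions

namespace NearOneDensity

open ZeroDetect NearOneDetect

/-! ## Part B1. Coefficient sums via `∑ d(n)²` -/

/-- **The coefficient sum of a block** without a pointwise divisor bound: for `M ≥ 1` and any
real `σ ≥ 0`, `∑_{M<n≤2M} |b(n)|² n^{−2σ} ≤ 2 M^{1−2σ} (1 + log(2M))³`, from `|b(n)| ≤ d(n)` and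
`∑_{n ≤ 2M} d(n)² ≤ 2M (1 + log 2M)³` (`Hallgren2005.sum_card_divisors_sq_le`). (The LH proof
`HalaszTuranLH` uses `d(n) ≤ C_ε n^ε` instead; near `σ = 1` the admissible `ε = O(η)` makes `C_ε`
unbounded, so the mean-square bound is used.) [cite: Ivic1985, §11.2 (11.6) and §11.4 (11.47)] -/
theorem sum_norm_coeffB_sq_le_log {σ : ℝ} (hσ : 0 ≤ σ) (X Y : ℕ) {M : ℕ} (hM : 1 ≤ M) :
    ∑ n ∈ Finset.Ioc M (2 * M), ‖ZeroDensity.coeffB X Y n‖ ^ 2 * (n : ℝ) ^ (-2 * σ) ≤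
      2 * (M : ℝ) ^ (1 - 2 * σ) * (1 + Real.log (2 * M)) ^ 3 := by
  have hM0 : (0 : ℝ) < M := by exact_mod_cast hM
  have hterm : ∀ n ∈ Finset.Ioc M (2 * M), ‖ZeroDensity.coeffB X Y n‖ ^ 2 * (n : ℝ) ^ (-2 * σ) ≤
      (M : ℝ) ^ (-2 * σ) * ((n.divisors.card ^ 2 : ℕ) : ℝ) := by
    intro n hn
    simp only [Finset.mem_Ioc] at hn
    have hn0 : (0 : ℝ) < n := by exact_mod_cast (by omega : 0 < n)
    have hMn : (M : ℝ) ≤ n := by exact_mod_cast hn.1.le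
    have h1 : ‖ZeroDensity.coeffB X Y n‖ ^ 2 ≤ ((n.divisors.card ^ 2 : ℕ) : ℝ) := by
      push_cast
      exact pow_le_pow_left₀ (norm_nonneg _) (ZeroDensity.norm_coeffB_le X Y n) 2
    have h2 : (n : ℝ) ^ (-2 * σ) ≤ (M : ℝ) ^ (-2 * σ) :=
      Real.rpow_le_rpow_of_nonpos hM0 hMn (by linarith)
    calc ‖ZeroDensity.coeffB X Y n‖ ^ 2 * (n : ℝ) ^ (-2 * σ)
        ≤ ((n.divisors.card ^ 2 : ℕ) : ℝ) * (M : ℝ) ^ (-2 * σ) :=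
          mul_le_mul h1 h2 (Real.rpow_nonneg hn0.le _) (by positivity)
      _ = (M : ℝ) ^ (-2 * σ) * ((n.divisors.card ^ 2 : ℕ) : ℝ) := mul_comm _ _
  have hsub : Finset.Ioc M (2 * M) ⊆ Finset.Icc 1 (2 * M) := fun n hn ↦ by
    simp only [Finset.mem_Ioc, Finset.mem_Icc] at hn ⊢; omega
  have hdiv := Literature.Computability.Cryptography.Hallgren2005.sum_card_divisors_sq_le (2 * M)
  calc ∑ n ∈ Finset.Ioc M (2 * M), ‖ZeroDensity.coeffB X Y n‖ ^ 2 * (n : ℝ) ^ (-2 * σ)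
      ≤ ∑ n ∈ Finset.Ioc M (2 * M), (M : ℝ) ^ (-2 * σ) * ((n.divisors.card ^ 2 : ℕ) : ℝ) :=
        Finset.sum_le_sum hterm
    _ = (M : ℝ) ^ (-2 * σ) * ∑ n ∈ Finset.Ioc M (2 * M), ((n.divisors.card ^ 2 : ℕ) : ℝ) := by
        rw [Finset.mul_sum]
    _ ≤ (M : ℝ) ^ (-2 * σ) * ∑ n ∈ Finset.Icc 1 (2 * M), ((n.divisors.card ^ 2 : ℕ) : ℝ) := by
        refine mul_le_mul_of_nonneg_left ?_ (Real.rpow_nonneg hM0.le _)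
        exact Finset.sum_le_sum_of_subset_of_nonneg hsub fun n _ _ ↦ by positivity
    _ ≤ (M : ℝ) ^ (-2 * σ) * (((2 * M : ℕ) : ℝ) * (1 + Real.log ((2 * M : ℕ) : ℝ)) ^ 3) := by
        refine mul_le_mul_of_nonneg_left ?_ (Real.rpow_nonneg hM0.le _)
        push_cast at hdiv ⊢
        exact hdiv
    _ = 2 * (M : ℝ) ^ (1 - 2 * σ) * (1 + Real.log (2 * M)) ^ 3 := by
        push_cast
        rw [show (1 : ℝ) - 2 * σ = -2 * σ + 1 by ring, Real.rpow_add hM0, Real.rpow_one]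
        ring

/-! ## Part B2. The Class-I count with the kernel at the line `α` -/

/-- **The Class-I count by Halász's lemma with the kernel at the line `α`** (Ivić (11.46)–(11.47):
`R₁ ≪ max_M M^{2−2σ} log⁶ T` once `X^{2σ−1−α} ≫ M(α,3T) log⁵ T`; the dyadic-block bookkeeping of
`HalaszTuranLH.classOne_halasz_count`). Let `1/2 ≤ α < 1`, `σ ≤ 1`, `α + 1 − 2σ ≤ 0` (so `σ ≥ 3/4`),
blocks `(X2^i, X2^{i+1}]`, `i < J`, with `X2^i < Y`, a sup bound `|ζ(α+it)| ≤ S` on `|t| ≤ 3U`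
and the crude bound `|ζ(α+it)| ≤ 1/(1−α) + K(1+|t|)`; put `Φ = 4S + 2/(1−α) + 6K`. Under the
absorption condition `18 · 64 J² · 8 Φ X^{α+1−2σ} (1 + log 2Y)³ ≤ 1`, a `1`-spaced set of
Class-I points `ρ` (`σ ≤ Re ρ < 1`, `U < Im ρ ≤ 2U`) has at most `267264 J³ Y^{2−2σ}(1+log 2Y)³`
elements. [cite: Ivic1985, §11.4 (11.46)–(11.48)] [cite: Titchmarsh1986, §9.28] -/
theorem classOne_count_line {α σ S K : ℝ} (hα : 1 / 2 ≤ α) (hα1 : α < 1)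
    (hσ1 : σ ≤ 1) (he : α + 1 - 2 * σ ≤ 0)
    {X Y J : ℕ} (hX : 1 ≤ X) (hY : 1 ≤ Y) (hJ : ∀ i < J, X * 2 ^ i < Y) {U : ℝ} (hU : 1 ≤ U)
    (hS0 : 0 ≤ S) (hK0 : 0 ≤ K)
    (hS : ∀ t : ℝ, |t| ≤ 3 * U → ‖riemannZeta ((α : ℂ) + t * I)‖ ≤ S)
    (hK : ∀ t : ℝ, ‖riemannZeta ((α : ℂ) + t * I)‖ ≤ 1 / (1 - α) + K * (1 + |t|))
    (habs : 18 * (64 * (J : ℝ) ^ 2) * (8 * (4 * S + 2 / (1 - α) + 6 * K) *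
      (X : ℝ) ^ (α + 1 - 2 * σ) * (1 + Real.log (2 * Y)) ^ 3) ≤ 1)
    (Z : Finset ℂ) (hZ : ∀ ρ ∈ Z, σ ≤ ρ.re ∧ ρ.re < 1 ∧ U < ρ.im ∧ ρ.im ≤ 2 * U)
    (hsep : ∀ ρ ∈ Z, ∀ ρ' ∈ Z, ρ ≠ ρ' → 1 ≤ |ρ.im - ρ'.im|)
    (hlarge : ∀ ρ ∈ Z, 1 / 8 ≤ ‖∑ n ∈ Finset.Ioc X (X * 2 ^ J),
      ZeroDensity.coeffB X Y n * (n : ℂ) ^ (-ρ)‖) :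
    (Z.card : ℝ) ≤ 267264 * (J : ℝ) ^ 3 * (Y : ℝ) ^ (2 - 2 * σ) * (1 + Real.log (2 * Y)) ^ 3 := by
  classical
  have h1α : 0 < 1 - α := by linarith
  set Φ : ℝ := 4 * S + 2 / (1 - α) + 6 * K with hΦdef
  have hΦ0 : 0 ≤ Φ := by rw [hΦdef]; positivity
  set S' : ℕ → ℂ → ℂ := fun i ρ ↦ ∑ n ∈ Finset.Ioc (X * 2 ^ i) (X * 2 ^ (i + 1)),
    ZeroDensity.coeffB X Y n * (n : ℂ) ^ (-ρ) with hS'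
  have hsplit : ∀ ρ, ∑ n ∈ Finset.Ioc X (X * 2 ^ J), ZeroDensity.coeffB X Y n * (n : ℂ) ^ (-ρ) =
      ∑ i ∈ Finset.range J, S' i ρ := fun ρ ↦ ZeroDensity.sum_Ioc_mul_two_pow _ X J
  -- the case `J = 0` is vacuous
  rcases Nat.eq_zero_or_pos J with hJ0 | hJpos
  · subst hJ0
    have : Z = ∅ := by
      rw [Finset.eq_empty_iff_forall_notMem]
      intro ρ hρ
      have h := hlarge ρ hρ
      rw [hsplit ρ] at h
      simp at h
      linarith
    rw [this]; simp
  have hJr : (1 : ℝ) ≤ J := by exact_mod_cast hJpos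
  have hY0 : (0 : ℝ) < Y := by exact_mod_cast (by omega : 0 < Y)
  have hY1r : (1 : ℝ) ≤ Y := by exact_mod_cast hY
  have hX0 : (0 : ℝ) < X := by exact_mod_cast hX
  have hlog2Y : 0 ≤ 1 + Real.log (2 * Y) := by
    have : 0 ≤ Real.log (2 * Y) := Real.log_nonneg (by linarith)
    linarith
  -- pigeonhole
  set V : ℝ := 1 / (8 * J) with hV
  have hV0 : 0 < V := by positivity
  have hVsq : V ^ 2 = 1 / (64 * J ^ 2) := by rw [hV]; field_simp; ring
  have hpig : ∀ ρ ∈ Z, ∃ i ∈ Finset.range J, V ≤ ‖S' i ρ‖ := by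
    intro ρ hρ
    by_contra hcon
    push Not at hcon
    have h1 := hlarge ρ hρ
    rw [hsplit ρ] at h1
    have h2 : ‖∑ i ∈ Finset.range J, S' i ρ‖ < 1 / 8 := by
      calc ‖∑ i ∈ Finset.range J, S' i ρ‖ ≤ ∑ i ∈ Finset.range J, ‖S' i ρ‖ := norm_sum_le _ _
        _ < ∑ i ∈ Finset.range J, V := Finset.sum_lt_sum_of_nonempty ⟨0, by simp; omega⟩ hcon
        _ = J * V := by simp
        _ = 1 / 8 := by rw [hV]; field_simp
    linarith
  have hcover : Z ⊆ (Finset.range J).biUnion (fun i ↦ Z.filter (fun ρ ↦ V ≤ ‖S' i ρ‖)) := by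
    intro ρ hρ
    rw [Finset.mem_biUnion]
    obtain ⟨i, hi, hVi⟩ := hpig ρ hρ
    exact ⟨i, hi, Finset.mem_filter.2 ⟨hρ, hVi⟩⟩
  -- the per-block count
  have hblock : ∀ i ∈ Finset.range J, ((Z.filter (fun ρ ↦ V ≤ ‖S' i ρ‖)).card : ℝ) ≤
      267264 * J ^ 2 * (Y : ℝ) ^ (2 - 2 * σ) * (1 + Real.log (2 * Y)) ^ 3 := by
    intro i hi
    rw [Finset.mem_range] at hi
    set M : ℕ := X * 2 ^ i with hM
    have hM1 : 1 ≤ M := by rw [hM]; exact Nat.le_mul_of_pos_right X (by positivity) |>.trans' hX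
    have hMX : X ≤ M := by rw [hM]; exact Nat.le_mul_of_pos_right X (by positivity)
    have hMY : M < Y := hJ i hi
    have hM0 : (0 : ℝ) < M := by exact_mod_cast hM1
    have hM1r : (1 : ℝ) ≤ M := by exact_mod_cast hM1
    have hMXr : (X : ℝ) ≤ M := by exact_mod_cast hMX
    have hMYr : (M : ℝ) ≤ Y := by exact_mod_cast hMY.le
    have h2M : X * 2 ^ (i + 1) = 2 * M := by rw [hM]; ring
    set Zi := Z.filter (fun ρ ↦ V ≤ ‖S' i ρ‖) with hZi
    set G : ℝ := ∑ n ∈ Finset.Ioc M (2 * M), ‖ZeroDensity.coeffB X Y n‖ ^ 2 * (n : ℝ) ^ (-2 * σ)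
      with hG
    have hG0 : 0 ≤ G := Finset.sum_nonneg fun n _ ↦ by positivity
    have hGle : G ≤ 2 * (M : ℝ) ^ (1 - 2 * σ) * (1 + Real.log (2 * M)) ^ 3 :=
      sum_norm_coeffB_sq_le_log (by linarith) X Y hM1
    have hlogM : 1 + Real.log (2 * M) ≤ 1 + Real.log (2 * Y) := by
      have := Real.log_le_log (by positivity : (0 : ℝ) < 2 * M) (by linarith : (2 : ℝ) * M ≤ 2 * Y)
      linarith
    have hlogM0 : 0 ≤ 1 + Real.log (2 * M) := by
      have : 0 ≤ Real.log (2 * M) := Real.log_nonneg (by linarith)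
      linarith
    set Φ₁ : ℝ := (((4 * M : ℕ) : ℝ)) ^ α * Φ with hΦ₁
    have hΦ₁0 : 0 ≤ Φ₁ := by positivity
    -- the kernel bound at the line `α`
    have hker : ∀ τ : ℝ, 1 ≤ |τ| → |τ| ≤ U →
        ‖∑ n ∈ Finset.Icc 1 (4 * M), ((((1 : ℝ) - (n : ℝ) / (4 * M : ℕ)) ^ 2 : ℝ) : ℂ) *
          (n : ℂ) ^ (-((τ : ℂ) * I))‖ ≤ 8 * M / |τ| ^ 3 + Φ₁ := by
      intro τ h1 h2
      have h := norm_smoothedKernel_le_line (Y := 4 * M) (by omega) hα hα1 hU hS0 hK0 hS hK h1 h2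
      have e : (2 : ℝ) * ((4 * M : ℕ) : ℝ) = 8 * M := by push_cast; ring
      rw [e] at h
      exact h
    -- the absorption condition for this block
    have habsM : 18 * Φ₁ * G ≤ V ^ 2 := by
      have h4M : (((4 * M : ℕ) : ℝ)) ^ α ≤ 4 * (M : ℝ) ^ α := by
        push_cast
        rw [Real.mul_rpow (by norm_num) hM0.le]
        refine mul_le_mul_of_nonneg_right ?_ (Real.rpow_nonneg hM0.le _)
        calc (4 : ℝ) ^ α ≤ (4 : ℝ) ^ (1 : ℝ) :=
              Real.rpow_le_rpow_of_exponent_le (by norm_num) hα1.le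
          _ = 4 := Real.rpow_one _
      have hMe : (M : ℝ) ^ α * (M : ℝ) ^ (1 - 2 * σ) = (M : ℝ) ^ (α + 1 - 2 * σ) := by
        rw [← Real.rpow_add hM0]; congr 1; ring
      have hMX' : (M : ℝ) ^ (α + 1 - 2 * σ) ≤ (X : ℝ) ^ (α + 1 - 2 * σ) :=
        Real.rpow_le_rpow_of_nonpos hX0 hMXr he
      calc 18 * Φ₁ * G ≤ 18 * (4 * (M : ℝ) ^ α * Φ) * (2 * (M : ℝ) ^ (1 - 2 * σ) *
            (1 + Real.log (2 * M)) ^ 3) := by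
            refine mul_le_mul (mul_le_mul_of_nonneg_left ?_ (by norm_num)) hGle hG0 (by positivity)
            exact mul_le_mul_of_nonneg_right h4M hΦ0
        _ = 18 * (8 * Φ * ((M : ℝ) ^ α * (M : ℝ) ^ (1 - 2 * σ)) * (1 + Real.log (2 * M)) ^ 3) := by
            ring
        _ = 18 * (8 * Φ * (M : ℝ) ^ (α + 1 - 2 * σ) * (1 + Real.log (2 * M)) ^ 3) := by rw [hMe]
        _ ≤ 18 * (8 * Φ * (X : ℝ) ^ (α + 1 - 2 * σ) * (1 + Real.log (2 * Y)) ^ 3) := by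
            gcongr
        _ ≤ 1 / (64 * J ^ 2) := by
            rw [le_div_iff₀ (by positivity)]
            calc 18 * (8 * Φ * (X : ℝ) ^ (α + 1 - 2 * σ) * (1 + Real.log (2 * Y)) ^ 3) *
                  (64 * J ^ 2)
                = 18 * (64 * (J : ℝ) ^ 2) * (8 * Φ * (X : ℝ) ^ (α + 1 - 2 * σ) *
                    (1 + Real.log (2 * Y)) ^ 3) := by ring
              _ ≤ 1 := habs
        _ = V ^ 2 := hVsq.symm
    have h1 := HalaszTuranLH.halasz_block_count (ZeroDensity.coeffB X Y) hM1 (σ := σ) (U := U)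
      hV0 hΦ₁0 Zi
      (fun ρ hρ ↦ by
        obtain ⟨hb, hb1, -, -⟩ := hZ ρ (Finset.mem_filter.1 hρ).1
        exact ⟨hb, by linarith⟩)
      (fun ρ hρ ↦ by
        obtain ⟨-, -, hg1, hg2⟩ := hZ ρ (Finset.mem_filter.1 hρ).1
        exact ⟨hg1, hg2⟩)
      (fun ρ hρ ρ' hρ' hne ↦ hsep ρ (Finset.mem_filter.1 hρ).1 ρ' (Finset.mem_filter.1 hρ').1 hne)
      hker
      (fun ρ hρ ↦ by
        have := (Finset.mem_filter.1 hρ).2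
        simp only [hS', h2M] at this
        exact this)
      habsM
    -- `2088 M G / V² ≤ 267264 J² Y^{2−2σ} (1 + log 2Y)³`
    have hMe2 : (M : ℝ) * (M : ℝ) ^ (1 - 2 * σ) = (M : ℝ) ^ (2 - 2 * σ) := by
      rw [show (2 : ℝ) - 2 * σ = 1 + (1 - 2 * σ) by ring, Real.rpow_add hM0, Real.rpow_one]
    have hMY' : (M : ℝ) ^ (2 - 2 * σ) ≤ (Y : ℝ) ^ (2 - 2 * σ) :=
      Real.rpow_le_rpow hM0.le hMYr (by linarith)
    calc (Zi.card : ℝ) ≤ 2088 * M * G / V ^ 2 := h1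
      _ = 2088 * (64 * J ^ 2) * (M * G) := by rw [hVsq]; field_simp
      _ ≤ 2088 * (64 * J ^ 2) * (M * (2 * (M : ℝ) ^ (1 - 2 * σ) * (1 + Real.log (2 * M)) ^ 3)) := by
          gcongr
      _ = 267264 * J ^ 2 * ((M : ℝ) * (M : ℝ) ^ (1 - 2 * σ)) * (1 + Real.log (2 * M)) ^ 3 := by
          ring
      _ ≤ 267264 * J ^ 2 * (Y : ℝ) ^ (2 - 2 * σ) * (1 + Real.log (2 * Y)) ^ 3 := by
          rw [hMe2]; gcongr
  -- sum over the blocks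
  calc (Z.card : ℝ)
      ≤ ((Finset.range J).biUnion (fun i ↦ Z.filter (fun ρ ↦ V ≤ ‖S' i ρ‖))).card := by
        exact_mod_cast Finset.card_le_card hcover
    _ ≤ ∑ i ∈ Finset.range J, ((Z.filter (fun ρ ↦ V ≤ ‖S' i ρ‖)).card : ℝ) := by
        exact_mod_cast Finset.card_biUnion_le
    _ ≤ ∑ i ∈ Finset.range J, 267264 * J ^ 2 * (Y : ℝ) ^ (2 - 2 * σ) * (1 + Real.log (2 * Y)) ^ 3 :=
        Finset.sum_le_sum hblock
    _ = _ := by rw [Finset.sum_const, Finset.card_range, nsmul_eq_mul]; ring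

/-! ## Part B3. From a well-spaced bound at one height to `N(σ, 2U) − N(σ, U)` -/

/-- **Representatives and windows at a single height** (Ivić (11.12); the tree's
`ZeroDensity.count_dyadic_le` with the well-spaced bound assumed only at the height `U` in
question): if every `1`-spaced set of zeros with `Re ρ ≥ σ`, `U < Im ρ ≤ 2U` has at most `W`
elements, then `N(σ, 2U) − N(σ, U) ≤ 2 W · C_w log(2U + 3)`, `C_w` the unit-window constant of
`exists_sum_zetaZeroWindow_le`. [cite: Ivic1985, §11.2 (11.11)–(11.12)] -/
theorem count_dyadic_le_at {σ W : ℝ} (hσ : 1 / 4 ≤ σ) {U : ℝ} (hU : 1 ≤ U)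
    (hws : ∀ Z : Finset ℂ,
      (∀ ρ ∈ Z, riemannZeta ρ = 0 ∧ σ ≤ ρ.re ∧ U < ρ.im ∧ ρ.im ≤ 2 * U) →
      (∀ ρ ∈ Z, ∀ ρ' ∈ Z, ρ ≠ ρ' → 1 ≤ |ρ.im - ρ'.im|) → (Z.card : ℝ) ≤ W)
    {Cw : ℝ} (hCw : ∀ τ : ℝ, ∑ ρ ∈ (zetaZeroWindow_finite τ).toFinset,
      (riemannZetaZeroOrder ρ : ℝ) ≤ Cw * Real.log (|τ| + 2)) :
    (zetaZeroCountRe σ (2 * U) : ℝ) - zetaZeroCountRe σ U ≤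
      2 * W * (Cw * Real.log (2 * U + 3)) := by
  classical
  set B₁ := (zetaZeroBox_finite σ U).toFinset with hB₁
  set B₂ := (zetaZeroBox_finite σ (2 * U)).toFinset with hB₂
  have hsub : B₁ ⊆ B₂ := by
    intro ρ hρ
    rw [hB₁, Set.Finite.mem_toFinset] at hρ
    rw [hB₂, Set.Finite.mem_toFinset]
    obtain ⟨h0, h1, h2, h3, h4⟩ := hρ
    exact ⟨h0, h1, h2, h3, by linarith⟩
  set D := B₂ \ B₁ with hD
  have hDmem : ∀ ρ ∈ D, riemannZeta ρ = 0 ∧ σ ≤ ρ.re ∧ ρ.re ≤ 1 ∧ U < ρ.im ∧ ρ.im ≤ 2 * U := by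
    intro ρ hρ
    rw [hD, Finset.mem_sdiff, hB₂, hB₁, Set.Finite.mem_toFinset, Set.Finite.mem_toFinset] at hρ
    obtain ⟨⟨h0, h1, h2, h3, h4⟩, hn⟩ := hρ
    refine ⟨h0, h1, h2, ?_, h4⟩
    by_contra hle
    exact hn ⟨h0, h1, h2, h3, not_lt.1 hle⟩
  have hdiff : (zetaZeroCountRe σ (2 * U) : ℝ) - zetaZeroCountRe σ U =
      ∑ ρ ∈ D, (riemannZetaZeroOrder ρ : ℝ) := by
    rw [natCast_zetaZeroCountRe, natCast_zetaZeroCountRe, ← hB₁, ← hB₂,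
      ← Finset.sum_sdiff hsub, hD]
    ring
  rw [hdiff]
  have hCw0 : 0 ≤ Cw := by
    have h := hCw 0
    have h0 : (0 : ℝ) ≤ ∑ ρ ∈ (zetaZeroWindow_finite 0).toFinset,
        (riemannZetaZeroOrder ρ : ℝ) := Finset.sum_nonneg fun ρ hρ ↦ by
      rw [Set.Finite.mem_toFinset] at hρ
      exact riemannZetaZeroOrder_nonneg_of_zero hρ.1
    have hl : 0 < Real.log (|(0 : ℝ)| + 2) := by simp; exact Real.log_pos (by norm_num)
    nlinarith
  -- group by `k = ⌊Im ρ⌋`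
  set f : ℂ → ℤ := fun ρ ↦ ⌊ρ.im⌋ with hf
  set Kset := D.image f with hKset
  have hfib : ∀ k ∈ Kset, ∑ ρ ∈ D with f ρ = k, (riemannZetaZeroOrder ρ : ℝ) ≤
      Cw * Real.log (2 * U + 3) := by
    intro k hk
    have hkU : (k : ℝ) ≤ 2 * U := by
      rw [hKset, Finset.mem_image] at hk
      obtain ⟨ρ, hρ, rfl⟩ := hk
      exact (Int.floor_le ρ.im).trans (hDmem ρ hρ).2.2.2.2
    have hk0 : (1 : ℝ) ≤ k := by
      rw [hKset, Finset.mem_image] at hk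
      obtain ⟨ρ, hρ, rfl⟩ := hk
      have h1 : (1 : ℤ) ≤ ⌊ρ.im⌋ := Int.le_floor.2 (by push_cast; linarith [(hDmem ρ hρ).2.2.2.1])
      exact_mod_cast h1
    set τ : ℝ := (k : ℝ) + 1 / 2 with hτ
    have hsubw : D.filter (fun ρ ↦ f ρ = k) ⊆ (zetaZeroWindow_finite τ).toFinset := by
      intro ρ hρ
      rw [Finset.mem_filter] at hρ
      rw [Set.Finite.mem_toFinset]
      obtain ⟨hρD, hρk⟩ := hρ
      obtain ⟨h0, h1, -, -, -⟩ := hDmem ρ hρD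
      refine ⟨h0, hσ.trans h1, ?_⟩
      have hfl := Int.floor_le ρ.im
      have hlt := Int.lt_floor_add_one ρ.im
      rw [show f ρ = ⌊ρ.im⌋ from rfl] at hρk
      rw [hρk] at hfl hlt
      rw [hτ, abs_le]
      constructor <;> linarith
    calc ∑ ρ ∈ D with f ρ = k, (riemannZetaZeroOrder ρ : ℝ)
        ≤ ∑ ρ ∈ (zetaZeroWindow_finite τ).toFinset, (riemannZetaZeroOrder ρ : ℝ) := by
          refine Finset.sum_le_sum_of_subset_of_nonneg hsubw fun ρ hρ _ ↦ ?_
          rw [Set.Finite.mem_toFinset] at hρ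
          exact riemannZetaZeroOrder_nonneg_of_zero hρ.1
      _ ≤ Cw * Real.log (|τ| + 2) := hCw τ
      _ ≤ Cw * Real.log (2 * U + 3) := by
          refine mul_le_mul_of_nonneg_left (Real.log_le_log (by positivity) ?_) hCw0
          rw [hτ, abs_of_pos (by linarith)]
          linarith
  -- number of groups
  have hcardK : (Kset.card : ℝ) ≤ 2 * W := by
    have hex : ∀ k ∈ Kset, ∃ ρ ∈ D, f ρ = k := fun k hk ↦ by
      simpa [hKset, Finset.mem_image] using hk
    choose! g hgD hgf using hex
    have hginj : Set.InjOn g Kset := by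
      intro k hk k' hk' h
      rw [← hgf k hk, ← hgf k' hk', h]
    have hclass : ∀ P : Finset ℤ, P ⊆ Kset → (∀ k ∈ P, ∀ k' ∈ P, k ≠ k' → 2 ≤ |k - k'|) →
        (P.card : ℝ) ≤ W := by
      intro P hP hP2
      have hcard : (P.image g).card = P.card := Finset.card_image_of_injOn (hginj.mono hP)
      rw [← hcard]
      refine hws (P.image g) (fun ρ hρ ↦ ?_) (fun ρ hρ ρ' hρ' hne ↦ ?_)
      · rw [Finset.mem_image] at hρ
        obtain ⟨k, hk, rfl⟩ := hρ
        obtain ⟨h0, h1, -, h3, h4⟩ := hDmem _ (hgD k (hP hk))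
        exact ⟨h0, h1, h3, h4⟩
      · rw [Finset.mem_image] at hρ hρ'
        obtain ⟨k, hk, rfl⟩ := hρ
        obtain ⟨k', hk', rfl⟩ := hρ'
        have hkk : k ≠ k' := fun h ↦ hne (by rw [h])
        have h2 := hP2 k hk k' hk' hkk
        have e1 : ⌊(g k).im⌋ = k := hgf k (hP hk)
        have e2 : ⌊(g k').im⌋ = k' := hgf k' (hP hk')
        have hfl := Int.floor_le (g k).im
        have hlt := Int.lt_floor_add_one (g k).im
        have hfl' := Int.floor_le (g k').im
        have hlt' := Int.lt_floor_add_one (g k').im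
        rw [e1] at hfl hlt
        rw [e2] at hfl' hlt'
        have h2' : (2 : ℝ) ≤ |(k : ℝ) - k'| := by exact_mod_cast h2
        rcases le_total (k : ℝ) k' with hle | hle
        · rw [abs_of_nonpos (by linarith)] at h2'
          rw [abs_of_nonpos (by linarith)]
          linarith
        · rw [abs_of_nonneg (by linarith)] at h2'
          rw [abs_of_nonneg (by linarith)]
          linarith
    have hE := hclass (Kset.filter (fun k ↦ Even k)) (Finset.filter_subset _ _) (by
      intro k hk k' hk' hne
      rw [Finset.mem_filter] at hk hk'
      have : Even (k - k') := Int.even_sub.2 (iff_of_true hk.2 hk'.2)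
      obtain ⟨r, hr⟩ := this
      rw [hr, show r + r = 2 * r by ring, abs_mul, abs_two]
      have : r ≠ 0 := by rintro rfl; simp at hr; exact hne (by linarith)
      have : 1 ≤ |r| := Int.one_le_abs this
      linarith)
    have hO := hclass (Kset.filter (fun k ↦ ¬ Even k)) (Finset.filter_subset _ _) (by
      intro k hk k' hk' hne
      rw [Finset.mem_filter] at hk hk'
      have : Even (k - k') := Int.even_sub.2 (iff_of_false hk.2 hk'.2)
      obtain ⟨r, hr⟩ := this
      rw [hr, show r + r = 2 * r by ring, abs_mul, abs_two]
      have : r ≠ 0 := by rintro rfl; simp at hr; exact hne (by linarith)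
      have : 1 ≤ |r| := Int.one_le_abs this
      linarith)
    have hsplit := Finset.card_filter_add_card_filter_not (s := Kset) (fun k ↦ Even k)
    have : (Kset.card : ℝ) = ((Kset.filter (fun k ↦ Even k)).card : ℝ) +
        ((Kset.filter (fun k ↦ ¬ Even k)).card : ℝ) := by exact_mod_cast hsplit.symm
    rw [this]
    linarith
  -- assemble
  have hmaps : ∀ ρ ∈ D, f ρ ∈ Kset := fun ρ hρ ↦ Finset.mem_image_of_mem f hρ
  rw [← Finset.sum_fiberwise_of_maps_to hmaps]
  have hlog0 : 0 ≤ Cw * Real.log (2 * U + 3) := mul_nonneg hCw0 (Real.log_nonneg (by linarith))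
  calc ∑ k ∈ Kset, ∑ ρ ∈ D with f ρ = k, (riemannZetaZeroOrder ρ : ℝ)
      ≤ ∑ k ∈ Kset, Cw * Real.log (2 * U + 3) := Finset.sum_le_sum hfib
    _ = Kset.card * (Cw * Real.log (2 * U + 3)) := by rw [Finset.sum_const, nsmul_eq_mul]
    _ ≤ 2 * W * (Cw * Real.log (2 * U + 3)) := mul_le_mul_of_nonneg_right hcardK hlog0

/-! ## Part B4. Parameters -/

/-- Ceiling facts: for `x ≥ 1`, `1 ≤ ⌈x⌉₊`, `x ≤ ⌈x⌉₊ ≤ 2x`. [folklore] -/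
private theorem natCeil_facts {x : ℝ} (hx : 1 ≤ x) :
    1 ≤ ⌈x⌉₊ ∧ x ≤ ((⌈x⌉₊ : ℕ) : ℝ) ∧ ((⌈x⌉₊ : ℕ) : ℝ) ≤ 2 * x := by
  refine ⟨?_, Nat.le_ceil x, ?_⟩
  · have : (1 : ℝ) ≤ ((⌈x⌉₊ : ℕ) : ℝ) := hx.trans (Nat.le_ceil x)
    exact_mod_cast this
  · have := (Nat.ceil_lt_add_one (by linarith : (0 : ℝ) ≤ x)).le
    linarith

/-- `(L^{a/η})^{η} = L^{a}` for `L ≥ 0`, `η ≠ 0`. [folklore] -/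
private theorem rpow_div_rpow {L a η : ℝ} (hL : 0 ≤ L) (hη : η ≠ 0) :
    (L ^ (a / η)) ^ η = L ^ a := by
  rw [← Real.rpow_mul hL]; congr 1; field_simp

/-- `(L^{a/η})^{kη} = L^{ka}` for `L ≥ 0`, `η ≠ 0`. [folklore] -/
private theorem rpow_div_rpow_mul {L a η k : ℝ} (hL : 0 ≤ L) (hη : η ≠ 0) :
    (L ^ (a / η)) ^ (k * η) = L ^ (k * a) := by
  rw [← Real.rpow_mul hL]; congr 1; field_simp

/-- `log L ≤ L` for `L > 0`. [folklore] -/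
private theorem log_le_self_of_pos {L : ℝ} (hL : 0 < L) : Real.log L ≤ L := by
  have := Real.log_le_sub_one_of_pos hL; linarith

/-- `(3η)^{3/2} ≤ 6 η^{3/2}` for `η ≥ 0` (`3^{3/2} ≤ 6`). [folklore] -/
private theorem three_mul_rpow_three_halves_le {η : ℝ} (hη : 0 ≤ η) :
    (3 * η) ^ (3 / 2 : ℝ) ≤ 6 * η ^ (3 / 2 : ℝ) := by
  rw [Real.mul_rpow (by norm_num) hη]
  refine mul_le_mul_of_nonneg_right ?_ (Real.rpow_nonneg hη _)
  have h : ((3 : ℝ) ^ (3 / 2 : ℝ)) ^ (2 : ℕ) ≤ (6 : ℝ) ^ (2 : ℕ) := by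
    rw [← Real.rpow_natCast, ← Real.rpow_mul (by norm_num)]
    norm_num
  exact (pow_le_pow_iff_left₀ (Real.rpow_nonneg (by norm_num) _) (by norm_num) two_ne_zero).1 h

/-- **The sup bound on the line `α = 1 − 3η`**: with the tree's Richert-type bound
(`exists_richertTypeBound_one`: `|ζ(σ+it)| ≤ A|t|^{B(1−σ)^{3/2}} log|t|`, `|t| ≥ 3`) and the crude
bound `|ζ(α+it)| ≤ 1/(1−α) + K(1+|t|)`, for `T ≥ 3`, `0 < η ≤ 1/12`, `1/η ≤ log T`:
`|ζ(1−3η+it)| ≤ 2A T^{12Bη^{3/2}} log T + log T + 4K` for `|t| ≤ 3T` (Ivić's `M(α, 3T)` with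
(11.53)). [cite: Ivic1985, §11.4 (11.53)] -/
theorem sup_bound_line {A B K : ℝ} (hA : 1 ≤ A) (hB : 0 ≤ B) (hK1 : 1 ≤ K)
    (hR : RichertTypeBound A B 1)
    (hK : ∀ α' t : ℝ, 1 / 2 ≤ α' → α' < 1 →
      ‖riemannZeta ((α' : ℂ) + t * I)‖ ≤ 1 / (1 - α') + K * (1 + |t|))
    {T η : ℝ} (hT : 3 ≤ T) (hη : 0 < η) (hη1 : η ≤ 1 / 12) (hηL : 1 / η ≤ Real.log T)
    {t : ℝ} (ht : |t| ≤ 3 * T) :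
    ‖riemannZeta (((1 - 3 * η : ℝ) : ℂ) + t * I)‖ ≤
      2 * A * T ^ (12 * B * η ^ (3 / 2 : ℝ)) * Real.log T + Real.log T + 4 * K := by
  have hT0 : 0 < T := by linarith
  have hT1 : 1 ≤ T := by linarith
  have hL0 : 0 < Real.log T := Real.log_pos (by linarith)
  have hα : 1 / 2 ≤ 1 - 3 * η := by linarith
  have hα1 : 1 - 3 * η < 1 := by linarith
  have hE1 : 1 ≤ T ^ (12 * B * η ^ (3 / 2 : ℝ)) := Real.one_le_rpow hT1 (by positivity)
  have hpos1 : 0 ≤ 2 * A * T ^ (12 * B * η ^ (3 / 2 : ℝ)) * Real.log T := by positivity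
  rcases lt_or_ge |t| 3 with h3 | h3
  · -- `|t| < 3`: the crude bound, `1/(3η) ≤ log T`
    have h := hK (1 - 3 * η) t hα hα1
    have h1 : 1 / (1 - (1 - 3 * η)) = 1 / (3 * η) := by ring
    rw [h1] at h
    have h2 : 1 / (3 * η) ≤ Real.log T := by
      calc 1 / (3 * η) ≤ 1 / η := by
            rw [div_le_div_iff₀ (by positivity) hη]; linarith
        _ ≤ Real.log T := hηL
    have h4 : K * (1 + |t|) ≤ 4 * K := by nlinarith
    linarith
  · -- `3 ≤ |t| ≤ 3T`: Richert
    have h := hR (1 - 3 * η) t h3 hα hα1.le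
    rw [Real.rpow_one, show 1 - (1 - 3 * η) = 3 * η by ring] at h
    have ht0 : 0 < |t| := by linarith
    have hexp0 : 0 ≤ B * (3 * η) ^ (3 / 2 : ℝ) := by positivity
    -- `|t|^{B(3η)^{3/2}} ≤ (3T)^{…} ≤ T^{2B(3η)^{3/2}} ≤ T^{12Bη^{3/2}}`
    have h1 : |t| ^ (B * (3 * η) ^ (3 / 2 : ℝ)) ≤ T ^ (12 * B * η ^ (3 / 2 : ℝ)) := by
      calc |t| ^ (B * (3 * η) ^ (3 / 2 : ℝ)) ≤ (3 * T) ^ (B * (3 * η) ^ (3 / 2 : ℝ)) :=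
            Real.rpow_le_rpow ht0.le ht hexp0
        _ ≤ (T ^ 2) ^ (B * (3 * η) ^ (3 / 2 : ℝ)) :=
            Real.rpow_le_rpow (by linarith) (by nlinarith) hexp0
        _ = T ^ (2 * (B * (3 * η) ^ (3 / 2 : ℝ))) := by
            rw [show (T ^ 2 : ℝ) = T ^ (2 : ℝ) by norm_cast, ← Real.rpow_mul hT0.le]
        _ ≤ T ^ (12 * B * η ^ (3 / 2 : ℝ)) := by
            refine Real.rpow_le_rpow_of_exponent_le hT1 ?_
            have := three_mul_rpow_three_halves_le hη.le
            nlinarith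
    have h2 : Real.log |t| ≤ 2 * Real.log T := by
      calc Real.log |t| ≤ Real.log (3 * T) := Real.log_le_log ht0 ht
        _ ≤ Real.log (T ^ 2) := Real.log_le_log (by linarith) (by nlinarith)
        _ = 2 * Real.log T := by rw [Real.log_pow]; norm_num
    have hlog0 : 0 ≤ Real.log |t| := Real.log_nonneg (by linarith)
    calc ‖riemannZeta (((1 - 3 * η : ℝ) : ℂ) + t * I)‖
        ≤ A * |t| ^ (B * (3 * η) ^ (3 / 2 : ℝ)) * Real.log |t| := h
      _ ≤ A * T ^ (12 * B * η ^ (3 / 2 : ℝ)) * (2 * Real.log T) := by gcongr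
      _ = 2 * A * T ^ (12 * B * η ^ (3 / 2 : ℝ)) * Real.log T := by ring
      _ ≤ 2 * A * T ^ (12 * B * η ^ (3 / 2 : ℝ)) * Real.log T + Real.log T + 4 * K := by
          nlinarith

/-- **The parameter `X = ⌈E' L^{12/η}⌉`**: with `E' ≥ 1`, `L ≥ 2`, `0 < η ≤ 1/12`, `1/η ≤ L`:
`X ≥ 1`, `X^η ≥ E'^η L^{12}`, `X^{3η} ≤ 2 E'^{3η} L^{36}`, `log X ≤ log E' + 13 L²`.
[folklore] -/
private theorem X_facts {E' L η : ℝ} (hE' : 1 ≤ E') (hL : 2 ≤ L) (hη : 0 < η) (hη1 : η ≤ 1 / 12)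
    (hηL : 1 / η ≤ L) :
    1 ≤ ⌈E' * L ^ (12 / η)⌉₊ ∧
    E' ^ η * L ^ 12 ≤ ((⌈E' * L ^ (12 / η)⌉₊ : ℕ) : ℝ) ^ η ∧
    ((⌈E' * L ^ (12 / η)⌉₊ : ℕ) : ℝ) ^ (3 * η) ≤ 2 * E' ^ (3 * η) * L ^ 36 ∧
    Real.log ((⌈E' * L ^ (12 / η)⌉₊ : ℕ) : ℝ) ≤ Real.log E' + 13 * L ^ 2 := by
  have hL0 : 0 < L := by linarith
  have hL1 : 1 ≤ L := by linarith
  have hP1 : 1 ≤ L ^ (12 / η) := Real.one_le_rpow hL1 (by positivity)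
  have hx1 : 1 ≤ E' * L ^ (12 / η) := by nlinarith
  have hx0 : 0 ≤ E' * L ^ (12 / η) := by linarith
  obtain ⟨hN1, hNge, hNle⟩ := natCeil_facts hx1
  set N : ℕ := ⌈E' * L ^ (12 / η)⌉₊ with hN
  have hN0 : (0 : ℝ) ≤ (N : ℝ) := Nat.cast_nonneg _
  refine ⟨hN1, ?_, ?_, ?_⟩
  · calc E' ^ η * L ^ 12 = (E' * L ^ (12 / η)) ^ η := by
          rw [Real.mul_rpow (by linarith) (by positivity), rpow_div_rpow hL0.le hη.ne']
          norm_num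
      _ ≤ (N : ℝ) ^ η := Real.rpow_le_rpow hx0 hNge hη.le
  · have h2 : (2 : ℝ) ^ (3 * η) ≤ 2 := by
      calc (2 : ℝ) ^ (3 * η) ≤ (2 : ℝ) ^ (1 : ℝ) :=
            Real.rpow_le_rpow_of_exponent_le (by norm_num) (by linarith)
        _ = 2 := Real.rpow_one _
    calc (N : ℝ) ^ (3 * η) ≤ (2 * (E' * L ^ (12 / η))) ^ (3 * η) :=
          Real.rpow_le_rpow hN0 hNle (by positivity)
      _ = (2 : ℝ) ^ (3 * η) * (E' ^ (3 * η) * L ^ 36) := by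
          rw [Real.mul_rpow (by norm_num) hx0, Real.mul_rpow (by linarith) (by positivity),
            rpow_div_rpow_mul hL0.le hη.ne']
          norm_num
      _ ≤ 2 * (E' ^ (3 * η) * L ^ 36) := by
          gcongr
      _ = 2 * E' ^ (3 * η) * L ^ 36 := by ring
  · have hlogL : Real.log L ≤ L := log_le_self_of_pos hL0
    have hlogL0 : 0 ≤ Real.log L := Real.log_nonneg hL1
    calc Real.log (N : ℝ) ≤ Real.log (2 * (E' * L ^ (12 / η))) :=
          Real.log_le_log (by positivity) hNle
      _ = Real.log 2 + Real.log E' + 12 / η * Real.log L := by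
          rw [Real.log_mul (by norm_num) (by positivity),
            Real.log_mul (by positivity) (by positivity), Real.log_rpow hL0]
          ring
      _ ≤ 1 + Real.log E' + 12 * L * L := by
          have h1 : Real.log 2 ≤ 1 := by
            have := Real.log_two_lt_d9; linarith
          have h2 : 12 / η * Real.log L ≤ 12 * L * L := by
            rw [div_mul_eq_mul_div, div_le_iff₀ hη]
            have : 1 ≤ L * η := by rwa [div_le_iff₀ hη] at hηL
            nlinarith
          linarith
      _ ≤ Real.log E' + 13 * L ^ 2 := by nlinarith

/-- **The parameter `Y = ⌈E'² L^{21/η}⌉`**: with `E' ≥ 1`, `L ≥ 2`, `0 < η ≤ 1/12`, `1/η ≤ L`: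
`Y ≥ 4`, `E'^{4η} L^{42} ≤ Y^{2η} ≤ 2E'^{4η}L^{42}`, `Y^{η} ≤ 2 E'^{2η} L^{21}`,
`1 + log(2Y) ≤ 2 log E' + 24 L²`, and `⌈E' L^{12/η}⌉ < Y`. [folklore] -/
private theorem Y_facts {E' L η : ℝ} (hE' : 1 ≤ E') (hL : 2 ≤ L) (hη : 0 < η) (hη1 : η ≤ 1 / 12)
    (hηL : 1 / η ≤ L) :
    4 ≤ ⌈E' ^ 2 * L ^ (21 / η)⌉₊ ∧
    E' ^ (4 * η) * L ^ 42 ≤ ((⌈E' ^ 2 * L ^ (21 / η)⌉₊ : ℕ) : ℝ) ^ (2 * η) ∧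
    ((⌈E' ^ 2 * L ^ (21 / η)⌉₊ : ℕ) : ℝ) ^ (2 * η) ≤ 2 * E' ^ (4 * η) * L ^ 42 ∧
    ((⌈E' ^ 2 * L ^ (21 / η)⌉₊ : ℕ) : ℝ) ^ η ≤ 2 * E' ^ (2 * η) * L ^ 21 ∧
    1 + Real.log (2 * ((⌈E' ^ 2 * L ^ (21 / η)⌉₊ : ℕ) : ℝ)) ≤ 2 * Real.log E' + 24 * L ^ 2 ∧
    ⌈E' * L ^ (12 / η)⌉₊ < ⌈E' ^ 2 * L ^ (21 / η)⌉₊ := by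
  have hL0 : 0 < L := by linarith
  have hL1 : 1 ≤ L := by linarith
  have hE'0 : 0 < E' := by linarith
  have h21η : (21 : ℝ) ≤ 21 / η := by
    rw [le_div_iff₀ hη]; nlinarith
  have hP1 : 1 ≤ L ^ (21 / η) := Real.one_le_rpow hL1 (by positivity)
  have hPL : L ^ (2 : ℝ) ≤ L ^ (21 / η) := Real.rpow_le_rpow_of_exponent_le hL1 (by linarith)
  have hE'2 : 1 ≤ E' ^ 2 := by nlinarith
  have hx1 : 1 ≤ E' ^ 2 * L ^ (21 / η) := by nlinarith
  have hx0 : 0 ≤ E' ^ 2 * L ^ (21 / η) := by linarith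
  obtain ⟨hN1, hNge, hNle⟩ := natCeil_facts hx1
  set N : ℕ := ⌈E' ^ 2 * L ^ (21 / η)⌉₊ with hN
  have hN0 : (0 : ℝ) ≤ (N : ℝ) := Nat.cast_nonneg _
  have hE'sq : (E' ^ 2 : ℝ) = E' ^ (2 : ℝ) := by norm_cast
  refine ⟨?_, ?_, ?_, ?_, ?_, ?_⟩
  · -- `4 ≤ Y`
    have h4 : (4 : ℝ) ≤ (N : ℝ) := by
      calc (4 : ℝ) = 2 ^ 2 := by norm_num
        _ ≤ L ^ 2 := by gcongr
        _ = L ^ (2 : ℝ) := by norm_cast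
        _ ≤ L ^ (21 / η) := hPL
        _ ≤ E' ^ 2 * L ^ (21 / η) := le_mul_of_one_le_left (by positivity) hE'2
        _ ≤ N := hNge
    exact_mod_cast h4
  · calc E' ^ (4 * η) * L ^ 42 = (E' ^ 2 * L ^ (21 / η)) ^ (2 * η) := by
          rw [Real.mul_rpow (by positivity) (by positivity), rpow_div_rpow_mul hL0.le hη.ne', hE'sq,
            ← Real.rpow_mul hE'0.le]
          norm_num
          left; ring_nf
      _ ≤ (N : ℝ) ^ (2 * η) := Real.rpow_le_rpow hx0 hNge (by positivity)
  · have h2 : (2 : ℝ) ^ (2 * η) ≤ 2 := by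
      calc (2 : ℝ) ^ (2 * η) ≤ (2 : ℝ) ^ (1 : ℝ) :=
            Real.rpow_le_rpow_of_exponent_le (by norm_num) (by linarith)
        _ = 2 := Real.rpow_one _
    calc (N : ℝ) ^ (2 * η) ≤ (2 * (E' ^ 2 * L ^ (21 / η))) ^ (2 * η) :=
          Real.rpow_le_rpow hN0 hNle (by positivity)
      _ = (2 : ℝ) ^ (2 * η) * (E' ^ (4 * η) * L ^ 42) := by
          rw [Real.mul_rpow (by norm_num) hx0, Real.mul_rpow (by positivity) (by positivity),
            rpow_div_rpow_mul hL0.le hη.ne', hE'sq, ← Real.rpow_mul hE'0.le]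
          norm_num
          left; left; ring_nf
      _ ≤ 2 * (E' ^ (4 * η) * L ^ 42) := by gcongr
      _ = 2 * E' ^ (4 * η) * L ^ 42 := by ring
  · have h2 : (2 : ℝ) ^ η ≤ 2 := by
      calc (2 : ℝ) ^ η ≤ (2 : ℝ) ^ (1 : ℝ) :=
            Real.rpow_le_rpow_of_exponent_le (by norm_num) (by linarith)
        _ = 2 := Real.rpow_one _
    calc (N : ℝ) ^ η ≤ (2 * (E' ^ 2 * L ^ (21 / η))) ^ η := Real.rpow_le_rpow hN0 hNle hη.le
      _ = (2 : ℝ) ^ η * (E' ^ (2 * η) * L ^ 21) := by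
          rw [Real.mul_rpow (by norm_num) hx0, Real.mul_rpow (by positivity) (by positivity),
            rpow_div_rpow hL0.le hη.ne', hE'sq, ← Real.rpow_mul hE'0.le]
          norm_num
      _ ≤ 2 * (E' ^ (2 * η) * L ^ 21) := by gcongr
      _ = 2 * E' ^ (2 * η) * L ^ 21 := by ring
  · have hlogL : Real.log L ≤ L := log_le_self_of_pos hL0
    have hlogL0 : 0 ≤ Real.log L := Real.log_nonneg hL1
    calc 1 + Real.log (2 * (N : ℝ)) ≤ 1 + Real.log (2 * (2 * (E' ^ 2 * L ^ (21 / η)))) := by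
          gcongr
      _ = 1 + (Real.log 4 + 2 * Real.log E' + 21 / η * Real.log L) := by
          rw [show (2 : ℝ) * (2 * (E' ^ 2 * L ^ (21 / η))) = 4 * (E' ^ 2 * L ^ (21 / η)) by ring,
            Real.log_mul (by norm_num) (by positivity),
            Real.log_mul (by positivity) (by positivity), Real.log_rpow hL0, Real.log_pow]
          push_cast
          ring
      _ ≤ 1 + (2 + 2 * Real.log E' + 21 * L * L) := by
          have h1 : Real.log 4 ≤ 2 := by
            rw [show (4 : ℝ) = 2 ^ 2 by norm_num, Real.log_pow]
            have := Real.log_two_lt_d9; push_cast; linarith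
          have h2 : 21 / η * Real.log L ≤ 21 * L * L := by
            rw [div_mul_eq_mul_div, div_le_iff₀ hη]
            have : 1 ≤ L * η := by rwa [div_le_iff₀ hη] at hηL
            nlinarith
          linarith
      _ ≤ 2 * Real.log E' + 24 * L ^ 2 := by nlinarith
  · -- `X < Y`
    have hX := (natCeil_facts (x := E' * L ^ (12 / η))
      (by nlinarith [Real.one_le_rpow hL1 (by positivity : (0:ℝ) ≤ 12 / η)])).2.2
    have h9 : (2 : ℝ) < L ^ (9 / η) := by
      have h9η : (9 : ℝ) ≤ 9 / η := by rw [le_div_iff₀ hη]; nlinarith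
      calc (2 : ℝ) < 2 ^ 9 := by norm_num
        _ ≤ L ^ 9 := by gcongr
        _ = L ^ (9 : ℝ) := by norm_cast
        _ ≤ L ^ (9 / η) := Real.rpow_le_rpow_of_exponent_le hL1 h9η
    have hlt : (((⌈E' * L ^ (12 / η)⌉₊ : ℕ) : ℝ)) < (N : ℝ) := by
      calc (((⌈E' * L ^ (12 / η)⌉₊ : ℕ) : ℝ)) ≤ 2 * (E' * L ^ (12 / η)) := hX
        _ = (2 * L ^ (12 / η)) * E' := by ring
        _ < (L ^ (9 / η) * L ^ (12 / η)) * E' ^ 2 := by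
            have h12 : 0 < L ^ (12 / η) := by positivity
            have hE'le : E' ≤ E' ^ 2 := by nlinarith
            calc (2 * L ^ (12 / η)) * E' < (L ^ (9 / η) * L ^ (12 / η)) * E' := by
                  gcongr
              _ ≤ (L ^ (9 / η) * L ^ (12 / η)) * E' ^ 2 := by gcongr
        _ = E' ^ 2 * L ^ (21 / η) := by
            rw [← Real.rpow_add hL0]; ring_nf
        _ ≤ N := hNge
    exact_mod_cast hlt

/-- **The dyadic index `J`**: for `X ≥ 1` there is `J` with `Y ≤ X·2^J`, `X·2^i < Y` for `i < J`,
and `J ≤ 1 + 2 log Y`. [folklore] -/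
private theorem J_facts {X Y : ℕ} (hX : 1 ≤ X) (hY : 1 ≤ Y) :
    ∃ J : ℕ, Y ≤ X * 2 ^ J ∧ (∀ i < J, X * 2 ^ i < Y) ∧ (J : ℝ) ≤ 1 + 2 * Real.log Y := by
  classical
  have hex : ∃ J : ℕ, Y ≤ X * 2 ^ J := by
    obtain ⟨n, hn⟩ := pow_unbounded_of_one_lt (Y : ℝ) (by norm_num : (1 : ℝ) < 2)
    refine ⟨n, ?_⟩
    have : (Y : ℝ) ≤ (X : ℝ) * 2 ^ n := by
      have hX1 : (1 : ℝ) ≤ X := by exact_mod_cast hX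
      nlinarith [hn.le, pow_pos (by norm_num : (0:ℝ) < 2) n]
    exact_mod_cast this
  refine ⟨Nat.find hex, Nat.find_spec hex, fun i hi ↦ ?_, ?_⟩
  · have := Nat.find_min hex hi
    omega
  · set J := Nat.find hex with hJ
    rcases Nat.eq_zero_or_pos J with h0 | hpos
    · rw [h0]; simp; positivity
    · have hmin : ¬ (Y ≤ X * 2 ^ (J - 1)) := Nat.find_min hex (by omega)
      have hlt : X * 2 ^ (J - 1) < Y := by omega
      have h2 : (2 : ℝ) ^ (J - 1) < Y := by
        have : 2 ^ (J - 1) ≤ X * 2 ^ (J - 1) := Nat.le_mul_of_pos_left _ hX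
        exact_mod_cast lt_of_le_of_lt this hlt
      have hY0 : (0 : ℝ) < Y := by exact_mod_cast hY
      have h3 : ((J - 1 : ℕ) : ℝ) * Real.log 2 < Real.log Y := by
        rw [← Real.log_pow]
        exact Real.log_lt_log (by positivity) h2
      have hlog2 : (1 : ℝ) / 2 ≤ Real.log 2 := by
        have := Real.log_two_gt_d9; linarith
      have hJ1 : ((J - 1 : ℕ) : ℝ) = (J : ℝ) - 1 := by
        rw [Nat.cast_sub hpos]; simp
      rw [hJ1] at h3
      have hlogY0 : 0 ≤ Real.log Y := Real.log_nonneg (by exact_mod_cast hY)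
      nlinarith


/-! ## Part B5. The well-spaced count for `1/log T ≤ η ≤ 1/12` -/

/-- Numerics: `S = 2AEL + L + 4K ≤ (2A+1+4K) E L` for `E, L ≥ 1`. [folklore] -/
private theorem numerics_S {A K E L : ℝ} (hK : 0 ≤ K) (hE : 1 ≤ E) (hL : 1 ≤ L) :
    2 * A * E * L + L + 4 * K ≤ (2 * A + 1 + 4 * K) * E * L := by
  have h1 : L ≤ E * L := le_mul_of_one_le_left (by linarith) hE
  have h2 : 1 ≤ E * L := one_le_mul_of_one_le_of_one_le hE hL
  nlinarith

/-- Numerics: `4S + 2/(3η) + 6K ≤ (4c_S+1+6K) E L`. [folklore] -/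
private theorem numerics_Φ {cS K E L η S : ℝ} (hK : 0 ≤ K) (hE : 1 ≤ E) (hL : 1 ≤ L)
    (hη : 0 < η) (hηL : 1 / η ≤ L) (hS : S ≤ cS * E * L) :
    4 * S + 2 / (3 * η) + 6 * K ≤ (4 * cS + 1 + 6 * K) * E * L := by
  have h1 : 2 / (3 * η) ≤ L := by
    calc 2 / (3 * η) ≤ 1 / η := by rw [div_le_div_iff₀ (by positivity) hη]; linarith
      _ ≤ L := hηL
  have h2 : L ≤ E * L := le_mul_of_one_le_left (by linarith) hE
  have h3 : 1 ≤ E * L := one_le_mul_of_one_le_of_one_le hE hL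
  nlinarith

/-- Numerics: the bounds `1 + log X ≤ (14+12B)L²`, `1 + log 2Y ≤ 24(1+B)L²`, `J ≤ 48(1+B)L²`.
[folklore] -/
private theorem numerics_logs {B L lE lX lY l2Y J : ℝ} (hB : 0 ≤ B) (hL : 1 ≤ L)
    (hlE : lE ≤ 12 * B * L) (hlX : lX ≤ lE + 13 * L ^ 2) (hl2Y : 1 + l2Y ≤ 2 * lE + 24 * L ^ 2)
    (hlY : lY ≤ l2Y) (hJ : J ≤ 1 + 2 * lY) :
    1 + lX ≤ (14 + 12 * B) * L ^ 2 ∧ 1 + l2Y ≤ 24 * (1 + B) * L ^ 2 ∧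
      J ≤ 48 * (1 + B) * L ^ 2 := by
  have h1 : 1 ≤ L ^ 2 := one_le_pow₀ hL
  have hL2 : L ≤ L ^ 2 := by nlinarith
  have hBL : 12 * B * L ≤ 12 * B * L ^ 2 := mul_le_mul_of_nonneg_left hL2 (by positivity)
  refine ⟨by linarith, by linarith, by linarith⟩

/-- Numerics: the absorption condition `18·64J²·8Φ X^{-η}(1+log 2Y)³ ≤ 1` once
`X^η ≥ E L^{12}` and `L ≥ 9216 c_J² c_Φ c_l³`. [folklore] -/
private theorem numerics_abs {E L J Φ Xη l cJ cΦ cl : ℝ} (hE : 1 ≤ E) (hL : 0 < L)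
    (hcΦ : 0 ≤ cΦ) (hJ0 : 0 ≤ J) (hJ : J ≤ cJ * L ^ 2) (hΦ0 : 0 ≤ Φ) (hΦ : Φ ≤ cΦ * E * L)
    (hX0 : 0 < Xη) (hXη : E * L ^ 12 ≤ Xη) (hl0 : 0 ≤ l) (hl : l ≤ cl * L ^ 2)
    (hcabs : 9216 * cJ ^ 2 * cΦ * cl ^ 3 ≤ L) :
    18 * (64 * J ^ 2) * (8 * Φ * Xη⁻¹ * l ^ 3) ≤ 1 := by
  have hE0 : 0 < E := by linarith
  have hXinv : Xη⁻¹ ≤ (E * L ^ 12)⁻¹ := inv_anti₀ (by positivity) hXη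
  calc 18 * (64 * J ^ 2) * (8 * Φ * Xη⁻¹ * l ^ 3)
      ≤ 18 * (64 * (cJ * L ^ 2) ^ 2) *
          (8 * (cΦ * E * L) * (E * L ^ 12)⁻¹ * (cl * L ^ 2) ^ 3) := by
        gcongr 18 * (64 * ?_ ^ 2) * (8 * ?_ * ?_ * ?_ ^ 3)
    _ = 9216 * cJ ^ 2 * cΦ * cl ^ 3 / L := by
        field_simp
        ring
    _ ≤ 1 := by rw [div_le_one hL]; exact hcabs

/-- Numerics: the Class-II kill condition once `X^{3η} ≤ 2E³L³⁶`, `Y^{2η} ≥ E⁴L⁴²` and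
`L ≥ 4(c_S/2 + 2 + 16K)`. [folklore] -/
private theorem numerics_kill {E L η K cS S Xr Yr U : ℝ} (hE : 1 ≤ E) (hL : 1 ≤ L) (hη : 0 < η)
    (hηL : 1 ≤ L * η) (hK : 0 ≤ K) (hcS : 0 ≤ cS) (hS0 : 0 ≤ S) (hS : S ≤ cS * E * L)
    (hcKL : 4 * (cS / 2 + 2 + 16 * K) ≤ L) (hU : 1 ≤ U)
    (hX : Xr ≤ 2 * E ^ 3 * L ^ 36) (hY : E ^ 4 * L ^ 42 ≤ Yr) :
    (1 + Xr / (3 * η)) * (2 * π * S / (2 * η) ^ 2 + π * (4 / (3 * η) + 16 * K) / U) <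
      5 * π / 8 * Yr := by
  obtain ⟨cK, hcK⟩ : ∃ cK : ℝ, cK = cS / 2 + 2 + 16 * K := ⟨_, rfl⟩
  rw [← hcK] at hcKL
  have hE0 : 0 < E := by linarith
  have hL0 : 0 < L := by linarith
  have hπ := Real.pi_pos
  -- the first factor
  have h1 : 1 + Xr / (3 * η) ≤ 2 * E ^ 3 * L ^ 37 := by
    have ha : Xr / (3 * η) ≤ 2 * E ^ 3 * L ^ 37 / 3 := by
      rw [div_le_iff₀ (by positivity)]
      have : Xr * 1 ≤ 2 * E ^ 3 * L ^ 36 * (L * η) :=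
        mul_le_mul hX hηL (by norm_num) (by positivity)
      nlinarith
    have hb : (1 : ℝ) ≤ E ^ 3 * L ^ 37 :=
      one_le_mul_of_one_le_of_one_le (one_le_pow₀ hE) (one_le_pow₀ hL)
    linarith
  -- the second factor
  have h2 : 2 * π * S / (2 * η) ^ 2 + π * (4 / (3 * η) + 16 * K) / U ≤ π * cK * E * L ^ 3 := by
    have ha : 2 * π * S / (2 * η) ^ 2 ≤ π / 2 * cS * E * L ^ 3 := by
      rw [div_le_iff₀ (by positivity)]
      have h1' : (1 : ℝ) ≤ (L * η) ^ 2 := one_le_pow₀ hηL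
      have : S * 1 ≤ cS * E * L * (L * η) ^ 2 := mul_le_mul hS h1' (by norm_num) (by positivity)
      nlinarith
    have hb : π * (4 / (3 * η) + 16 * K) / U ≤ π * (2 + 16 * K) * L := by
      have h4 : 4 / (3 * η) ≤ 2 * L := by
        rw [div_le_iff₀ (by positivity)]; nlinarith
      calc π * (4 / (3 * η) + 16 * K) / U ≤ π * (4 / (3 * η) + 16 * K) :=
            div_le_self (by positivity) hU
        _ ≤ π * (2 * L + 16 * K * L) := by
            apply mul_le_mul_of_nonneg_left _ hπ.le
            have h5 : 16 * K ≤ 16 * K * L := le_mul_of_one_le_right (by positivity) hL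
            linarith
        _ = π * (2 + 16 * K) * L := by ring
    have hc : π / 2 * cS * E * L ^ 3 + π * (2 + 16 * K) * L ≤ π * cK * E * L ^ 3 := by
      rw [hcK]
      have hEL : 1 ≤ E * L ^ 2 := one_le_mul_of_one_le_of_one_le hE (one_le_pow₀ hL)
      have : L ≤ E * L ^ 3 := by nlinarith
      nlinarith [mul_nonneg (mul_nonneg hπ.le (by positivity : (0 : ℝ) ≤ 2 + 16 * K))
        (sub_nonneg.2 this)]
    linarith
  have h3 : (1 + Xr / (3 * η)) * (2 * π * S / (2 * η) ^ 2 + π * (4 / (3 * η) + 16 * K) / U) ≤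
      (2 * E ^ 3 * L ^ 37) * (π * cK * E * L ^ 3) :=
    mul_le_mul h1 h2 (by positivity) (by positivity)
  have hcK2 : 2 ≤ cK := by rw [hcK]; linarith
  have h5 : 2 * cK < 5 / 8 * L ^ 2 := by nlinarith
  have hEL : 0 < E ^ 4 * L ^ 40 := by positivity
  calc (1 + Xr / (3 * η)) * (2 * π * S / (2 * η) ^ 2 + π * (4 / (3 * η) + 16 * K) / U)
      ≤ (2 * E ^ 3 * L ^ 37) * (π * cK * E * L ^ 3) := h3
    _ = (2 * cK) * π * (E ^ 4 * L ^ 40) := by ring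
    _ < (5 / 8 * L ^ 2) * π * (E ^ 4 * L ^ 40) := by gcongr
    _ = 5 * π / 8 * (E ^ 4 * L ^ 42) := by ring
    _ ≤ 5 * π / 8 * Yr := by gcongr

/-- Numerics: the residue condition `2Y^η(1+log X)/U³ ≤ 1/8` once
`U ≥ 32(14+12B)E²L²³`. [folklore] -/
private theorem numerics_res {E L B Yη lX U : ℝ} (hY0 : 0 ≤ Yη)
    (hY : Yη ≤ 2 * E ^ 2 * L ^ 21) (hlX0 : 0 ≤ lX) (hlX : lX ≤ (14 + 12 * B) * L ^ 2)
    (hU1 : 1 ≤ U) (hU : 32 * (14 + 12 * B) * E ^ 2 * L ^ 23 ≤ U) :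
    2 * Yη * lX / U ^ 3 ≤ 1 / 8 := by
  have hU0 : 0 < U := by linarith
  have hU3 : U ≤ U ^ 3 := by
    calc U = U * 1 * 1 := by ring
      _ ≤ U * U * U := by gcongr
      _ = U ^ 3 := by ring
  have hEL : 0 ≤ 2 * E ^ 2 * L ^ 21 := hY0.trans hY
  rw [div_le_iff₀ (by positivity)]
  calc 2 * Yη * lX ≤ 2 * (2 * E ^ 2 * L ^ 21) * ((14 + 12 * B) * L ^ 2) := by gcongr
    _ = 1 / 8 * (32 * (14 + 12 * B) * E ^ 2 * L ^ 23) := by ring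
    _ ≤ 1 / 8 * U := by gcongr
    _ ≤ 1 / 8 * U ^ 3 := by gcongr

/-- Numerics: `267264 J³ Y^{2η} (1+log 2Y)³ ≤ C_W E⁴ L⁵⁴`. [folklore] -/
private theorem numerics_final {E L J Y2 l cJ cl : ℝ} (hcJ : 0 ≤ cJ) (hJ0 : 0 ≤ J)
    (hJ : J ≤ cJ * L ^ 2) (hY0 : 0 ≤ Y2) (hY : Y2 ≤ 2 * E ^ 4 * L ^ 42)
    (hl0 : 0 ≤ l) (hl : l ≤ cl * L ^ 2) :
    267264 * J ^ 3 * Y2 * l ^ 3 ≤ 267264 * cJ ^ 3 * (2 * cl ^ 3) * E ^ 4 * L ^ 54 := by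
  have hEL : 0 ≤ 2 * E ^ 4 * L ^ 42 := hY0.trans hY
  calc 267264 * J ^ 3 * Y2 * l ^ 3
      ≤ 267264 * (cJ * L ^ 2) ^ 3 * (2 * E ^ 4 * L ^ 42) * (cl * L ^ 2) ^ 3 := by gcongr
    _ = 267264 * cJ ^ 3 * (2 * cl ^ 3) * E ^ 4 * L ^ 54 := by ring

/-- **The well-spaced count near `σ = 1`** (Ivić's proof of Theorem 11.3 with `k = 3` and
Class II made empty): with the tree's Richert-type bound (constants `A, B`) and the crude bound
(constant `K`), there are `L₀, C_W, C_γ` such that for `T ≥ e^{L₀}`, `1/log T ≤ η ≤ 1/12`,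
`C_γ T^{24Bη^{3/2}} (log T)^{23} ≤ U ≤ T`, every `1`-spaced set of zeros `ρ` with `Re ρ ≥ 1 − η`,
`U < Im ρ ≤ 2U` has at most `C_W T^{48Bη^{3/2}} (log T)^{54}` elements. Parameters:
`α = 1 − 3η`, `X = ⌈T^{12Bη^{1/2}}(log T)^{12/η}⌉`, `Y = ⌈T^{24Bη^{1/2}}(log T)^{21/η}⌉`.
[cite: Ivic1985, §11.4, proof of Theorem 11.3, (11.44)–(11.53)] -/
theorem wellSpaced_le {A B K : ℝ} (hA : 1 ≤ A) (hB : 0 ≤ B) (hK1 : 1 ≤ K)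
    (hR : RichertTypeBound A B 1)
    (hK : ∀ α' t : ℝ, 1 / 2 ≤ α' → α' < 1 →
      ‖riemannZeta ((α' : ℂ) + t * I)‖ ≤ 1 / (1 - α') + K * (1 + |t|)) :
    ∃ L₀ CW Cγ : ℝ, 2 ≤ L₀ ∧ 0 < CW ∧ 1 ≤ Cγ ∧
      ∀ T : ℝ, Real.exp L₀ ≤ T → ∀ η : ℝ, 1 / Real.log T ≤ η → η ≤ 1 / 12 →
      ∀ U : ℝ, Cγ * T ^ (24 * B * η ^ (3 / 2 : ℝ)) * Real.log T ^ 23 ≤ U → U ≤ T →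
      ∀ Z : Finset ℂ,
        (∀ ρ ∈ Z, riemannZeta ρ = 0 ∧ 1 - η ≤ ρ.re ∧ U < ρ.im ∧ ρ.im ≤ 2 * U) →
        (∀ ρ ∈ Z, ∀ ρ' ∈ Z, ρ ≠ ρ' → 1 ≤ |ρ.im - ρ'.im|) →
        (Z.card : ℝ) ≤ CW * T ^ (48 * B * η ^ (3 / 2 : ℝ)) * Real.log T ^ 54 := by
  -- the constants
  obtain ⟨cS, hcS⟩ : ∃ c : ℝ, c = 2 * A + 1 + 4 * K := ⟨_, rfl⟩
  obtain ⟨cΦ, hcΦ⟩ : ∃ c : ℝ, c = 4 * cS + 1 + 6 * K := ⟨_, rfl⟩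
  obtain ⟨cK, hcK⟩ : ∃ c : ℝ, c = cS / 2 + 2 + 16 * K := ⟨_, rfl⟩
  obtain ⟨cJ, hcJ⟩ : ∃ c : ℝ, c = 48 * (1 + B) := ⟨_, rfl⟩
  obtain ⟨cl, hcl⟩ : ∃ c : ℝ, c = 24 * (1 + B) := ⟨_, rfl⟩
  obtain ⟨cabs, hcabs⟩ : ∃ c : ℝ, c = 9216 * cJ ^ 2 * cΦ * cl ^ 3 := ⟨_, rfl⟩
  obtain ⟨Cγ, hCγ⟩ : ∃ c : ℝ, c = 32 * (14 + 12 * B) := ⟨_, rfl⟩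
  have hcS0 : 0 ≤ cS := by rw [hcS]; positivity
  have hcΦ0 : 0 ≤ cΦ := by rw [hcΦ]; positivity
  have hcJ0 : 0 < cJ := by rw [hcJ]; positivity
  have hcl0 : 0 < cl := by rw [hcl]; positivity
  have hCγ1 : 1 ≤ Cγ := by rw [hCγ]; nlinarith
  refine ⟨max 2 (max cabs (4 * cK)), 267264 * cJ ^ 3 * (2 * cl ^ 3), Cγ, le_max_left _ _,
    by positivity, hCγ1, ?_⟩
  intro T hT η hηL hη12 U hU1 hUT Z hZ hsep
  -- basics on `T`, `L = log T`, `η`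
  have hT0 : 0 < T := lt_of_lt_of_le (Real.exp_pos _) hT
  have hlogT : max 2 (max cabs (4 * cK)) ≤ Real.log T := by
    have h := Real.log_le_log (Real.exp_pos _) hT
    rwa [Real.log_exp] at h
  have hT3 : 3 ≤ T := by
    calc (3 : ℝ) = 2 + 1 := by norm_num
      _ ≤ Real.exp 2 := Real.add_one_le_exp 2
      _ ≤ Real.exp (max 2 (max cabs (4 * cK))) := Real.exp_le_exp.2 (le_max_left _ _)
      _ ≤ T := hT
  have hT1 : 1 ≤ T := by linarith
  obtain ⟨L, hL⟩ : ∃ L : ℝ, L = Real.log T := ⟨_, rfl⟩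
  rw [← hL] at hlogT hηL hU1
  rw [← hL]
  have hL2 : 2 ≤ L := (le_max_left _ _).trans hlogT
  have hcabsL : cabs ≤ L := ((le_max_left _ _).trans (le_max_right _ _)).trans hlogT
  have hcKL : 4 * cK ≤ L := ((le_max_right _ _).trans (le_max_right _ _)).trans hlogT
  have hL1 : 1 ≤ L := by linarith
  have hL0 : 0 < L := by linarith
  have hη0 : 0 < η := lt_of_lt_of_le (by positivity) hηL
  have hηL' : 1 / η ≤ L := by
    rw [div_le_iff₀ hη0]
    rw [div_le_iff₀ hL0] at hηL
    linarith
  have hηLT : 1 / η ≤ Real.log T := hL ▸ hηL'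
  have hη1 : η ≤ 1 := by linarith
  have hηinvL : 1 ≤ L * η := by rwa [div_le_iff₀ hη0] at hηL'
  -- `σ = 1 - η`, `α = 1 - 3η`
  have hα : 1 / 2 ≤ 1 - 3 * η := by linarith
  have hα1 : 1 - 3 * η < 1 := by linarith
  have hασ : 1 - 3 * η < 1 - η := by linarith
  have hσ1 : 1 - η ≤ 1 := by linarith
  have he : (1 - 3 * η) + 1 - 2 * (1 - η) ≤ 0 := by linarith
  have h3η : 1 - (1 - 3 * η) = 3 * η := by ring
  have h2η : 1 - η - (1 - 3 * η) = 2 * η := by ring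
  -- `E' = T^{12Bη^{1/2}}`, `E = T^{12Bη^{3/2}}`
  obtain ⟨E', hE'⟩ : ∃ E' : ℝ, E' = T ^ (12 * B * η ^ (1 / 2 : ℝ)) := ⟨_, rfl⟩
  obtain ⟨E, hE⟩ : ∃ E : ℝ, E = T ^ (12 * B * η ^ (3 / 2 : ℝ)) := ⟨_, rfl⟩
  have hE'1 : 1 ≤ E' := hE' ▸ Real.one_le_rpow hT1 (by positivity)
  have hE1 : 1 ≤ E := hE ▸ Real.one_le_rpow hT1 (by positivity)
  have hE0 : 0 < E := by linarith
  have hE'k : ∀ k : ℝ, E' ^ (k * η) = E ^ k := by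
    intro k
    rw [hE', hE, ← Real.rpow_mul hT0.le, ← Real.rpow_mul hT0.le]
    congr 1
    have : η ^ (3 / 2 : ℝ) = η ^ (1 / 2 : ℝ) * η := by
      rw [show (3 / 2 : ℝ) = 1 / 2 + 1 by norm_num, Real.rpow_add hη0, Real.rpow_one]
    rw [this]; ring
  have hE'η : E' ^ η = E := by simpa using hE'k 1
  have hE'2η : E' ^ (2 * η) = E ^ 2 := by rw [hE'k 2]; norm_cast
  have hE'3η : E' ^ (3 * η) = E ^ 3 := by rw [hE'k 3]; norm_cast
  have hE'4η : E' ^ (4 * η) = E ^ 4 := by rw [hE'k 4]; norm_cast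
  have hE2T : E ^ 2 = T ^ (24 * B * η ^ (3 / 2 : ℝ)) := by
    rw [hE, ← Real.rpow_mul_natCast hT0.le]; congr 1; push_cast; ring
  have hE4T : E ^ 4 = T ^ (48 * B * η ^ (3 / 2 : ℝ)) := by
    rw [hE, ← Real.rpow_mul_natCast hT0.le]; congr 1; push_cast; ring
  rw [← hE2T] at hU1
  rw [← hE4T]
  have hU1' : 1 ≤ U := by
    have : (1 : ℝ) ≤ Cγ * E ^ 2 * L ^ 23 := by
      have h2 : (1 : ℝ) ≤ E ^ 2 := one_le_pow₀ hE1
      have h3 : (1 : ℝ) ≤ L ^ 23 := one_le_pow₀ hL1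
      calc (1 : ℝ) = 1 * 1 * 1 := by ring
        _ ≤ Cγ * E ^ 2 * L ^ 23 := by gcongr
    linarith
  -- the sup bound `S` on the line `α = 1 - 3η`
  obtain ⟨S, hSdef⟩ : ∃ S : ℝ, S = 2 * A * E * L + L + 4 * K := ⟨_, rfl⟩
  have hS0 : 0 ≤ S := by rw [hSdef]; positivity
  have hK0 : 0 ≤ K := by linarith
  have hS : ∀ t : ℝ, |t| ≤ 3 * U → ‖riemannZeta (((1 - 3 * η : ℝ) : ℂ) + t * I)‖ ≤ S := by
    intro t ht
    have h := sup_bound_line hA hB hK1 hR hK hT3 hη0 hη12 hηLT (t := t) (by linarith)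
    rw [← hE, ← hL, ← hSdef] at h
    exact h
  have hSle : S ≤ cS * E * L := by
    rw [hSdef, hcS]; exact numerics_S hK0 hE1 hL1
  have hKα : ∀ t : ℝ, ‖riemannZeta (((1 - 3 * η : ℝ) : ℂ) + t * I)‖ ≤
      1 / (1 - (1 - 3 * η)) + K * (1 + |t|) := fun t ↦ hK _ t hα hα1
  have hΦ0 : 0 ≤ 4 * S + 2 / (1 - (1 - 3 * η)) + 6 * K := by rw [h3η]; positivity
  have hΦle : 4 * S + 2 / (1 - (1 - 3 * η)) + 6 * K ≤ cΦ * E * L := by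
    rw [h3η, hcΦ]; exact numerics_Φ hK0 hE1 hL1 hη0 hηL' hSle
  -- the parameters `X`, `Y`, `J`
  obtain ⟨hX1, hXη, hX3η, hlogX⟩ := X_facts hE'1 hL2 hη0 hη12 hηL'
  obtain ⟨hY4, hY2η, hY2η', hYη, hlog2Y, hXY⟩ := Y_facts hE'1 hL2 hη0 hη12 hηL'
  obtain ⟨X, hXdef⟩ : ∃ X : ℕ, X = ⌈E' * L ^ (12 / η)⌉₊ := ⟨_, rfl⟩
  obtain ⟨Y, hYdef⟩ : ∃ Y : ℕ, Y = ⌈E' ^ 2 * L ^ (21 / η)⌉₊ := ⟨_, rfl⟩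
  rw [← hXdef] at hX1 hXη hX3η hlogX hXY
  rw [← hYdef] at hY4 hY2η hY2η' hYη hlog2Y hXY
  rw [hE'η] at hXη
  rw [hE'3η] at hX3η
  rw [hE'4η] at hY2η hY2η'
  rw [hE'2η] at hYη
  have hY1 : 1 ≤ Y := le_trans (by norm_num) hY4
  have hX0 : (0 : ℝ) < X := by exact_mod_cast hX1
  have hY1r : (1 : ℝ) ≤ Y := by exact_mod_cast hY1
  have hY0 : (0 : ℝ) < Y := by linarith
  obtain ⟨J, hJ, hJlt, hJle⟩ := J_facts hX1 hY1
  have hJ0 : (0 : ℝ) ≤ J := Nat.cast_nonneg _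
  -- the logarithms
  have hlogE' : Real.log E' ≤ 12 * B * L := by
    rw [hE', Real.log_rpow hT0, ← hL]
    have h1 : η ^ (1 / 2 : ℝ) ≤ 1 := Real.rpow_le_one hη0.le hη1 (by norm_num)
    have h2 : 0 ≤ 12 * B * L := by positivity
    calc 12 * B * η ^ (1 / 2 : ℝ) * L = η ^ (1 / 2 : ℝ) * (12 * B * L) := by ring
      _ ≤ 1 * (12 * B * L) := by gcongr
      _ = 12 * B * L := one_mul _
  obtain ⟨hlogX', hlog2Y', hJle'⟩ := numerics_logs hB hL1 hlogE' hlogX hlog2Y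
    (Real.log_le_log hY0 (by linarith)) hJle
  rw [← hcl] at hlog2Y'
  rw [← hcJ] at hJle'
  have hlogX0 : 0 ≤ 1 + Real.log (X : ℝ) := by
    have : 0 ≤ Real.log (X : ℝ) := Real.log_nonneg (by exact_mod_cast hX1)
    linarith
  have hlog2Y0 : 0 ≤ 1 + Real.log (2 * (Y : ℝ)) := by
    have : 0 ≤ Real.log (2 * (Y : ℝ)) := Real.log_nonneg (by linarith)
    linarith
  -- the absorption condition
  have habs : 18 * (64 * (J : ℝ) ^ 2) * (8 * (4 * S + 2 / (1 - (1 - 3 * η)) + 6 * K) *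
      (X : ℝ) ^ ((1 - 3 * η) + 1 - 2 * (1 - η)) * (1 + Real.log (2 * Y)) ^ 3) ≤ 1 := by
    have hexp : (1 - 3 * η) + 1 - 2 * (1 - η) = -η := by ring
    rw [hexp, Real.rpow_neg hX0.le]
    rw [hcabs] at hcabsL
    exact numerics_abs hE1 hL0 hcΦ0 hJ0 hJle' hΦ0 hΦle (by positivity) hXη hlog2Y0 hlog2Y'
      hcabsL
  -- the Class-II kill condition
  have hkill : (1 + (X : ℝ) ^ (1 - (1 - 3 * η)) / (1 - (1 - 3 * η))) *
      (2 * π * S / (1 - η - (1 - 3 * η)) ^ 2 + π * (4 / (1 - (1 - 3 * η)) + 16 * K) / U) <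
        5 * π / 8 * (Y : ℝ) ^ (1 - η - (1 - 3 * η)) := by
    rw [h3η, h2η]
    rw [hcK] at hcKL
    exact numerics_kill hE1 hL1 hη0 hηinvL hK0 hcS0 hS0 hSle hcKL hU1' hX3η hY2η
  -- the residue condition
  have hres : 2 * (Y : ℝ) ^ (1 - (1 - η)) * (1 + Real.log X) / U ^ 3 ≤ 1 / 8 := by
    rw [show (1 : ℝ) - (1 - η) = η by ring]
    rw [hCγ] at hU1
    exact numerics_res (by positivity) hYη hlogX0 hlogX' hU1' hU1
  -- every zero of `Z` is of Class I
  have hclassI : ∀ ρ ∈ Z, 1 / 8 ≤ ‖∑ n ∈ Finset.Ioc X (X * 2 ^ J),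
      ZeroDensity.coeffB X Y n * (n : ℂ) ^ (-ρ)‖ := by
    intro ρ hρ
    obtain ⟨h0, hβ, hγ1, hγ2⟩ := hZ ρ hρ
    exact classOne_of_sup_line (σ := 1 - η) (α := 1 - 3 * η) hα hασ hS0 hK0 hX1 hY4 hJ
      hU1' hres hS hK hkill h0 hβ hγ1 hγ2
  -- the Class-I count
  have hZ' : ∀ ρ ∈ Z, 1 - η ≤ ρ.re ∧ ρ.re < 1 ∧ U < ρ.im ∧ ρ.im ≤ 2 * U := by
    intro ρ hρ
    obtain ⟨h0, hβ, hγ1, hγ2⟩ := hZ ρ hρ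
    refine ⟨hβ, ?_, hγ1, hγ2⟩
    by_contra h
    exact riemannZeta_ne_zero_of_one_le_re (not_lt.1 h) h0
  have hcount := classOne_count_line (σ := 1 - η) (α := 1 - 3 * η) hα hα1 hσ1 he hX1 hY1 hJlt
    hU1' hS0 hK0 hS hKα habs Z hZ' hsep hclassI
  -- final numerics
  rw [show (2 : ℝ) - 2 * (1 - η) = 2 * η by ring] at hcount
  calc (Z.card : ℝ) ≤ 267264 * (J : ℝ) ^ 3 * (Y : ℝ) ^ (2 * η) * (1 + Real.log (2 * Y)) ^ 3 :=
        hcount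
    _ ≤ 267264 * cJ ^ 3 * (2 * cl ^ 3) * E ^ 4 * L ^ 54 :=
        numerics_final hcJ0.le hJ0 hJle' (by positivity) hY2η' hlog2Y0 hlog2Y'


/-! ## Part B6. Dyadic summation and the three regimes -/

/-- Telescoping over the dyadic chain `γ₀ 2^j`, `j < J₂`. [folklore] -/
private theorem dyadic_telescope (σ γ₀ D N₀ : ℝ) (hN₀ : (zetaZeroCountRe σ γ₀ : ℝ) ≤ N₀) :
    ∀ J₂ : ℕ, (∀ j < J₂, (zetaZeroCountRe σ (2 * (γ₀ * 2 ^ j)) : ℝ) -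
      zetaZeroCountRe σ (γ₀ * 2 ^ j) ≤ D) →
      (zetaZeroCountRe σ (γ₀ * 2 ^ J₂) : ℝ) ≤ N₀ + J₂ * D := by
  intro J₂
  induction J₂ with
  | zero => intro _; simpa using hN₀
  | succ n ih =>
      intro h
      have h1 := ih (fun j hj ↦ h j (by omega))
      have h2 := h n (by omega)
      have h3 : γ₀ * 2 ^ (n + 1) = 2 * (γ₀ * 2 ^ n) := by ring
      rw [h3]
      push_cast
      linarith

/-- The trivial count `N(σ, V) ≤ 6 C₃ V log T` for `1 ≤ V ≤ T`, `T ≥ 3`, from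
`exists_zetaZeroCountRe_le_mul_log`. [folklore] -/
private theorem trivial_count {C₃ : ℝ}
    (hC₃ : ∀ σ : ℝ, 1 / 4 ≤ σ → ∀ T : ℝ, 1 ≤ T →
      (zetaZeroCountRe σ T : ℝ) ≤ C₃ * (T + 2) * Real.log (T + 2))
    {T V σ : ℝ} (hT : 3 ≤ T) (hV : 1 ≤ V) (hVT : V ≤ T) (hσ : 1 / 4 ≤ σ) (hC₃0 : 0 ≤ C₃) :
    (zetaZeroCountRe σ V : ℝ) ≤ 6 * C₃ * V * Real.log T := by
  have hV0 : 0 < V := by linarith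
  have h1 : V + 2 ≤ 3 * V := by linarith
  have h2 : Real.log (V + 2) ≤ 2 * Real.log T := by
    have h3 : Real.log 3 ≤ Real.log T := Real.log_le_log (by norm_num) hT
    calc Real.log (V + 2) ≤ Real.log (3 * T) := Real.log_le_log (by linarith) (by linarith)
      _ = Real.log 3 + Real.log T := Real.log_mul (by norm_num) (by linarith)
      _ ≤ 2 * Real.log T := by linarith
  have h4 : 0 ≤ Real.log (V + 2) := Real.log_nonneg (by linarith)
  calc (zetaZeroCountRe σ V : ℝ) ≤ C₃ * (V + 2) * Real.log (V + 2) := hC₃ σ hσ V hV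
    _ ≤ C₃ * (3 * V) * (2 * Real.log T) := by gcongr
    _ = 6 * C₃ * V * Real.log T := by ring

/-- **The count in the main regime** `1/log T ≤ η ≤ 1/12` (Ivić (11.12) + (11.53)): with `B`
the exponent constant of `exists_richertTypeBound_one`, there are `C_m, L₁` with
`N(1 − η, T) ≤ C_m T^{48Bη^{3/2}} (log T)^{56}` for `T ≥ e^{L₁}`: the well-spaced count
`wellSpaced_le` on each dyadic block `γ₀ 2^j < T` (at most `3 log T` blocks,
`count_dyadic_le_at`), and the trivial count below `γ₀ = C_γ T^{24Bη^{3/2}}(log T)^{23}`.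
[cite: Ivic1985, §11.2 (11.12), §11.4 (11.53)] -/
theorem count_main : ∃ B₁ Cm L₁ : ℝ, 0 ≤ B₁ ∧ 0 < Cm ∧ 2 ≤ L₁ ∧
    ∀ T : ℝ, Real.exp L₁ ≤ T → ∀ η : ℝ, 1 / Real.log T ≤ η → η ≤ 1 / 12 →
      (zetaZeroCountRe (1 - η) T : ℝ) ≤ Cm * T ^ (B₁ * η ^ (3 / 2 : ℝ)) * Real.log T ^ 56 := by
  classical
  obtain ⟨A, B, hA1, hB0, hR⟩ := exists_richertTypeBound_one
  obtain ⟨K, hK1, hK⟩ := exists_norm_zeta_line_le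
  obtain ⟨L₀, CW, Cγ, hL₀2, hCW0, hCγ1, hW⟩ := wellSpaced_le hA1 hB0 hK1 hR hK
  obtain ⟨Cw, hCw0, hCw⟩ := exists_sum_zetaZeroWindow_le
  obtain ⟨C₃, hC₃0, hC₃⟩ := exists_zetaZeroCountRe_le_mul_log
  refine ⟨48 * B, 6 * C₃ * Cγ + 12 * Cw * CW, L₀, by positivity, by positivity, hL₀2, ?_⟩
  intro T hT η hηLT hη12
  have hT0 : 0 < T := lt_of_lt_of_le (Real.exp_pos _) hT
  have hLL₀ : L₀ ≤ Real.log T := by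
    have h := Real.log_le_log (Real.exp_pos _) hT
    rwa [Real.log_exp] at h
  have hT3 : 3 ≤ T := by
    calc (3 : ℝ) = 2 + 1 := by norm_num
      _ ≤ Real.exp 2 := Real.add_one_le_exp 2
      _ ≤ Real.exp L₀ := Real.exp_le_exp.2 hL₀2
      _ ≤ T := hT
  have hT1 : 1 ≤ T := by linarith
  obtain ⟨L, hL⟩ : ∃ L : ℝ, L = Real.log T := ⟨_, rfl⟩
  have hηL : 1 / L ≤ η := by rw [hL]; exact hηLT
  rw [← hL] at hLL₀ ⊢
  have hL2 : 2 ≤ L := hL₀2.trans hLL₀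
  have hL1 : 1 ≤ L := by linarith
  have hL0 : 0 < L := by linarith
  have hη0 : 0 < η := lt_of_lt_of_le (by positivity) hηL
  have hσ : 1 / 4 ≤ 1 - η := by linarith
  -- `E₂ = T^{24Bη^{3/2}} ≤ E₄ = T^{48Bη^{3/2}}`
  obtain ⟨E₂, hE₂⟩ : ∃ E : ℝ, E = T ^ (24 * B * η ^ (3 / 2 : ℝ)) := ⟨_, rfl⟩
  obtain ⟨E₄, hE₄⟩ : ∃ E : ℝ, E = T ^ (48 * B * η ^ (3 / 2 : ℝ)) := ⟨_, rfl⟩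
  have hE₂1 : 1 ≤ E₂ := hE₂ ▸ Real.one_le_rpow hT1 (by positivity)
  have hE₂4 : E₂ ≤ E₄ := by
    rw [hE₂, hE₄]
    refine Real.rpow_le_rpow_of_exponent_le hT1 ?_
    have : 0 ≤ B * η ^ (3 / 2 : ℝ) := by positivity
    linarith
  have hE₄0 : 0 ≤ E₄ := by linarith
  rw [← hE₄]
  -- `γ₀ = C_γ E₂ L²³ ≥ 1` and `W = C_W E₄ L⁵⁴`
  obtain ⟨γ₀, hγ₀⟩ : ∃ g : ℝ, g = Cγ * E₂ * L ^ 23 := ⟨_, rfl⟩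
  have hγ₀1 : 1 ≤ γ₀ := by
    rw [hγ₀]
    have h3 : (1 : ℝ) ≤ L ^ 23 := one_le_pow₀ hL1
    calc (1 : ℝ) = 1 * 1 * 1 := by ring
      _ ≤ Cγ * E₂ * L ^ 23 := by gcongr
  obtain ⟨W, hWdef⟩ : ∃ w : ℝ, w = CW * E₄ * L ^ 54 := ⟨_, rfl⟩
  have hW0 : 0 ≤ W := by rw [hWdef]; positivity
  -- the dyadic increments for `γ₀ ≤ U < T`
  have hinc : ∀ U : ℝ, γ₀ ≤ U → U < T →
      (zetaZeroCountRe (1 - η) (2 * U) : ℝ) - zetaZeroCountRe (1 - η) U ≤ 4 * Cw * W * L := by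
    intro U hU1 hU2
    have hU : 1 ≤ U := hγ₀1.trans hU1
    have hws : ∀ Z : Finset ℂ,
        (∀ ρ ∈ Z, riemannZeta ρ = 0 ∧ 1 - η ≤ ρ.re ∧ U < ρ.im ∧ ρ.im ≤ 2 * U) →
        (∀ ρ ∈ Z, ∀ ρ' ∈ Z, ρ ≠ ρ' → 1 ≤ |ρ.im - ρ'.im|) → (Z.card : ℝ) ≤ W := by
      intro Z hZ hsep
      have hU1' : Cγ * T ^ (24 * B * η ^ (3 / 2 : ℝ)) * Real.log T ^ 23 ≤ U := by
        rw [← hE₂, ← hL, ← hγ₀]; exact hU1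
      have h := hW T hT η hηLT hη12 U hU1' hU2.le Z hZ hsep
      rw [← hE₄, ← hL, ← hWdef] at h
      exact h
    have h := count_dyadic_le_at hσ hU hws hCw
    have hlog : Real.log (2 * U + 3) ≤ 2 * L := by
      have h3 : Real.log 3 ≤ Real.log T := Real.log_le_log (by norm_num) hT3
      calc Real.log (2 * U + 3) ≤ Real.log (3 * T) :=
            Real.log_le_log (by linarith) (by linarith)
        _ = Real.log 3 + Real.log T := Real.log_mul (by norm_num) hT0.ne'
        _ ≤ 2 * L := by rw [← hL]; linarith
    calc (zetaZeroCountRe (1 - η) (2 * U) : ℝ) - zetaZeroCountRe (1 - η) U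
        ≤ 2 * W * (Cw * Real.log (2 * U + 3)) := h
      _ ≤ 2 * W * (Cw * (2 * L)) := by gcongr
      _ = 4 * Cw * W * L := by ring
  -- the trivial count below `T`
  have htriv : ∀ V : ℝ, 1 ≤ V → V ≤ T →
      (zetaZeroCountRe (1 - η) V : ℝ) ≤ 6 * C₃ * V * L := by
    intro V hV hVT
    have h := trivial_count hC₃ hT3 hV hVT hσ hC₃0.le
    rwa [← hL] at h
  -- the final comparison of constants
  have hfin : 6 * C₃ * γ₀ * L + 3 * L * (4 * Cw * W * L) ≤
      (6 * C₃ * Cγ + 12 * Cw * CW) * E₄ * L ^ 56 := by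
    rw [hγ₀, hWdef]
    have h1 : E₂ * L ^ 24 ≤ E₄ * L ^ 56 :=
      mul_le_mul hE₂4 (pow_le_pow_right₀ hL1 (by norm_num)) (by positivity) hE₄0
    have h2 : 6 * C₃ * (Cγ * E₂ * L ^ 23) * L = 6 * C₃ * Cγ * (E₂ * L ^ 24) := by ring
    have h3 : 3 * L * (4 * Cw * (CW * E₄ * L ^ 54) * L) = 12 * Cw * CW * (E₄ * L ^ 56) := by
      ring
    rw [h2, h3]
    have h4 : 0 ≤ 6 * C₃ * Cγ := by positivity
    nlinarith [mul_le_mul_of_nonneg_left h1 h4]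
  rcases le_or_gt T γ₀ with hTγ | hTγ
  · -- `T ≤ γ₀`: the trivial bound suffices
    have h := htriv T hT1 le_rfl
    have h1 : 6 * C₃ * T * L ≤ 6 * C₃ * γ₀ * L := by gcongr
    have h0 : 0 ≤ 3 * L * (4 * Cw * W * L) := by positivity
    linarith
  · -- the dyadic chain `γ₀ 2^j`, `j < J₂`, `J₂` least with `T ≤ γ₀ 2^{J₂}`
    have hex : ∃ j : ℕ, T ≤ γ₀ * 2 ^ j := by
      obtain ⟨n, hn⟩ := pow_unbounded_of_one_lt T (by norm_num : (1 : ℝ) < 2)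
      exact ⟨n, hn.le.trans (le_mul_of_one_le_left (by positivity) hγ₀1)⟩
    have hJ₂spec : T ≤ γ₀ * 2 ^ Nat.find hex := Nat.find_spec hex
    have hJ₂min : ∀ j < Nat.find hex, γ₀ * 2 ^ j < T :=
      fun j hj ↦ not_le.1 (Nat.find_min hex hj)
    -- `J₂ ≤ 3L`
    have hJ₂le : ((Nat.find hex : ℕ) : ℝ) ≤ 3 * L := by
      have hj₀ : T ≤ γ₀ * 2 ^ ⌈2 * L⌉₊ := by
        have h2 : T ≤ (2 : ℝ) ^ ⌈2 * L⌉₊ := by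
          have ha : Real.log T ≤ ⌈2 * L⌉₊ * Real.log 2 := by
            have hc : 2 * L ≤ ⌈2 * L⌉₊ := Nat.le_ceil _
            have hl2 : 1 / 2 < Real.log 2 := by
              have := Real.log_two_gt_d9; linarith
            rw [← hL]
            nlinarith
          calc T = Real.exp (Real.log T) := (Real.exp_log hT0).symm
            _ ≤ Real.exp (⌈2 * L⌉₊ * Real.log 2) := Real.exp_le_exp.2 ha
            _ = 2 ^ ⌈2 * L⌉₊ := by rw [← Real.log_pow, Real.exp_log (by positivity)]
        exact h2.trans (le_mul_of_one_le_left (by positivity) hγ₀1)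
      have h1 : Nat.find hex ≤ ⌈2 * L⌉₊ := Nat.find_min' hex hj₀
      have h2 : ((Nat.find hex : ℕ) : ℝ) ≤ ⌈2 * L⌉₊ := by exact_mod_cast h1
      have h3 : (⌈2 * L⌉₊ : ℝ) < 2 * L + 1 := Nat.ceil_lt_add_one (by positivity)
      linarith
    have hmono : (zetaZeroCountRe (1 - η) T : ℝ) ≤
        zetaZeroCountRe (1 - η) (γ₀ * 2 ^ Nat.find hex) := by
      exact_mod_cast zetaZeroCountRe_mono_right_holds (1 - η) hJ₂spec
    have htel := dyadic_telescope (1 - η) γ₀ (4 * Cw * W * L) (6 * C₃ * γ₀ * L)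
      (htriv γ₀ hγ₀1 hTγ.le) (Nat.find hex)
      (fun j hj ↦ hinc _ (le_mul_of_one_le_right (by linarith) (one_le_pow₀ (by norm_num)))
        (hJ₂min j hj))
    have h0 : 0 ≤ 4 * Cw * W * L := by positivity
    have h1 : ((Nat.find hex : ℕ) : ℝ) * (4 * Cw * W * L) ≤ 3 * L * (4 * Cw * W * L) := by
      gcongr
    linarith

end NearOneDensity

/-- **Discharge of `NearOneZeroDensity`** (Ivić 1985, Theorem 11.3 in the shape (11.33);
Montgomery 1971, Thm. 12.3 / Cor. 12.5): there are `B, C, T₀` with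
`N(σ, T) ≤ T^{B(1−σ)^{3/2}} (log T)^{C}` for `T ≥ T₀` and `1/2 ≤ σ ≤ 1`. Three regimes:
`1 − σ > 1/12` (trivial count `N(σ,T) ≪ T log T`), `1/log T ≤ 1 − σ ≤ 1/12`
(`NearOneDensity.count_main`), `1 − σ < 1/log T` (monotonicity in `σ` from `σ = 1 − 1/log T`,
where `T^{48B(log T)^{-3/2}} ≤ e^{48B}`). [cite: Ivic1985, §11.4 Theorem 11.3 (11.33),
pp. 277–281] [cite: Montgomery1971, Theorem 12.3 and Corollary 12.5] -/
theorem nearOneZeroDensity_holds : NearOneZeroDensity := by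
  obtain ⟨B₁, Cm, L₁, hB₁, hCm, hL₁, hmain⟩ := NearOneDensity.count_main
  obtain ⟨C₃, hC₃0, hC₃⟩ := exists_zetaZeroCountRe_le_mul_log
  obtain ⟨L₂, hL₂⟩ : ∃ l : ℝ, l = max (max L₁ 12) (max (6 * C₃) (Cm * Real.exp B₁)) := ⟨_, rfl⟩
  have hL₂a : L₁ ≤ L₂ := hL₂ ▸ (le_max_left _ _).trans (le_max_left _ _)
  have hL₂b : 12 ≤ L₂ := hL₂ ▸ (le_max_right _ _).trans (le_max_left _ _)
  have hL₂c : 6 * C₃ ≤ L₂ := hL₂ ▸ (le_max_left _ _).trans (le_max_right _ _)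
  have hL₂d : Cm * Real.exp B₁ ≤ L₂ := hL₂ ▸ (le_max_right _ _).trans (le_max_right _ _)
  refine ⟨B₁ + 288, 57, Real.exp L₂, by positivity, ?_⟩
  intro T hT σ hσ hσ1
  have hT0 : 0 < T := lt_of_lt_of_le (Real.exp_pos _) hT
  have hLL₂ : L₂ ≤ Real.log T := by
    have h := Real.log_le_log (Real.exp_pos _) hT
    rwa [Real.log_exp] at h
  have hT3 : 3 ≤ T := by
    calc (3 : ℝ) = 2 + 1 := by norm_num
      _ ≤ Real.exp 2 := Real.add_one_le_exp 2
      _ ≤ Real.exp L₂ := Real.exp_le_exp.2 (by linarith)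
      _ ≤ T := hT
  have hT1 : 1 ≤ T := by linarith
  rw [show (57 : ℝ) = ((57 : ℕ) : ℝ) by norm_num, Real.rpow_natCast]
  obtain ⟨L, hL⟩ : ∃ L : ℝ, L = Real.log T := ⟨_, rfl⟩
  rw [← hL] at hLL₂ ⊢
  have hL₁L : L₁ ≤ L := hL₂a.trans hLL₂
  have hL12 : 12 ≤ L := hL₂b.trans hLL₂
  have hC₃L : 6 * C₃ ≤ L := hL₂c.trans hLL₂
  have hCmL : Cm * Real.exp B₁ ≤ L := hL₂d.trans hLL₂
  have hL1 : 1 ≤ L := by linarith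
  have hL0 : 0 < L := by linarith
  have hTexp : Real.exp L₁ ≤ T := by
    calc Real.exp L₁ ≤ Real.exp L := Real.exp_le_exp.2 hL₁L
      _ = T := by rw [hL, Real.exp_log hT0]
  have hη0 : 0 ≤ 1 - σ := by linarith
  have hη1 : 1 - σ ≤ 1 := by linarith
  have hpow1 : 1 ≤ T ^ ((B₁ + 288) * (1 - σ) ^ (3 / 2 : ℝ)) :=
    Real.one_le_rpow hT1 (by positivity)
  rcases lt_or_ge (1 / 12 : ℝ) (1 - σ) with hbig | hsmall
  · -- the regime `1 - σ > 1/12`: the trivial count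
    have h := NearOneDensity.trivial_count hC₃ hT3 hT1 le_rfl (by linarith : 1 / 4 ≤ σ) hC₃0.le
    rw [← hL] at h
    have hexp : 1 ≤ (B₁ + 288) * (1 - σ) ^ (3 / 2 : ℝ) := by
      have h1 : (1 - σ) ^ (2 : ℝ) ≤ (1 - σ) ^ (3 / 2 : ℝ) :=
        Real.rpow_le_rpow_of_exponent_ge (by linarith) hη1 (by norm_num)
      have h2 : (1 / 144 : ℝ) ≤ (1 - σ) ^ (2 : ℝ) := by
        rw [show (2 : ℝ) = ((2 : ℕ) : ℝ) by norm_num, Real.rpow_natCast]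
        nlinarith [mul_self_le_mul_self (by norm_num : (0 : ℝ) ≤ 1 / 12) hbig.le]
      have h4 : 0 ≤ B₁ * (1 - σ) ^ (3 / 2 : ℝ) := by positivity
      calc (1 : ℝ) ≤ 288 * (1 / 144) := by norm_num
        _ ≤ 288 * (1 - σ) ^ (3 / 2 : ℝ) := by linarith
        _ ≤ (B₁ + 288) * (1 - σ) ^ (3 / 2 : ℝ) := by linarith
    have hTle : T ≤ T ^ ((B₁ + 288) * (1 - σ) ^ (3 / 2 : ℝ)) := by
      calc T = T ^ (1 : ℝ) := (Real.rpow_one T).symm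
        _ ≤ T ^ ((B₁ + 288) * (1 - σ) ^ (3 / 2 : ℝ)) :=
            Real.rpow_le_rpow_of_exponent_le hT1 hexp
    have hCL : 6 * C₃ * L ≤ L ^ 57 := by
      calc 6 * C₃ * L ≤ L * L := mul_le_mul_of_nonneg_right hC₃L hL0.le
        _ = L ^ 2 := by ring
        _ ≤ L ^ 57 := pow_le_pow_right₀ hL1 (by norm_num)
    calc (zetaZeroCountRe σ T : ℝ) ≤ 6 * C₃ * T * L := h
      _ = T * (6 * C₃ * L) := by ring
      _ ≤ T ^ ((B₁ + 288) * (1 - σ) ^ (3 / 2 : ℝ)) * L ^ 57 :=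
          mul_le_mul hTle hCL (by positivity) (by positivity)
  · rcases le_or_gt (1 / L) (1 - σ) with hmid | htiny
    · -- the main regime `1/L ≤ 1 - σ ≤ 1/12`
      have h := hmain T hTexp (1 - σ) (by rw [← hL]; exact hmid) hsmall
      rw [sub_sub_cancel, ← hL] at h
      have hCm1 : Cm ≤ L :=
        (le_mul_of_one_le_right hCm.le (Real.one_le_exp_iff.2 hB₁)).trans hCmL
      have hTpow : T ^ (B₁ * (1 - σ) ^ (3 / 2 : ℝ)) ≤ T ^ ((B₁ + 288) * (1 - σ) ^ (3 / 2 : ℝ)) := by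
        refine Real.rpow_le_rpow_of_exponent_le hT1 ?_
        have : 0 ≤ (1 - σ) ^ (3 / 2 : ℝ) := by positivity
        nlinarith
      calc (zetaZeroCountRe σ T : ℝ) ≤ Cm * T ^ (B₁ * (1 - σ) ^ (3 / 2 : ℝ)) * L ^ 56 := h
        _ ≤ L * T ^ ((B₁ + 288) * (1 - σ) ^ (3 / 2 : ℝ)) * L ^ 56 := by gcongr
        _ = T ^ ((B₁ + 288) * (1 - σ) ^ (3 / 2 : ℝ)) * L ^ 57 := by ring
    · -- the regime `1 - σ < 1/L`: monotonicity in `σ` from `σ' = 1 - 1/L`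
      have hanti : (zetaZeroCountRe σ T : ℝ) ≤ zetaZeroCountRe (1 - 1 / L) T := by
        exact_mod_cast zetaZeroCountRe_anti_left_holds T (by linarith : 1 - 1 / L ≤ σ)
      have h := hmain T hTexp (1 / L) (by rw [← hL]) (one_div_le_one_div_of_le (by norm_num) hL12)
      rw [← hL] at h
      have hTB : T ^ (B₁ * (1 / L) ^ (3 / 2 : ℝ)) ≤ Real.exp B₁ := by
        have h1 : (1 / L) ^ (3 / 2 : ℝ) ≤ (1 / L) ^ (1 : ℝ) :=
          Real.rpow_le_rpow_of_exponent_ge (by positivity) (by rw [div_le_one hL0]; linarith)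
            (by norm_num)
        rw [Real.rpow_one] at h1
        calc T ^ (B₁ * (1 / L) ^ (3 / 2 : ℝ)) ≤ T ^ (B₁ * (1 / L)) :=
              Real.rpow_le_rpow_of_exponent_le hT1 (mul_le_mul_of_nonneg_left h1 hB₁)
          _ = Real.exp B₁ := by
              rw [Real.rpow_def_of_pos hT0, ← hL]
              congr 1
              field_simp
      calc (zetaZeroCountRe σ T : ℝ) ≤ zetaZeroCountRe (1 - 1 / L) T := hanti
        _ ≤ Cm * T ^ (B₁ * (1 / L) ^ (3 / 2 : ℝ)) * L ^ 56 := h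
        _ ≤ Cm * Real.exp B₁ * L ^ 56 := by gcongr
        _ ≤ L * L ^ 56 := by gcongr
        _ = 1 * L ^ 57 := by ring
        _ ≤ T ^ ((B₁ + 288) * (1 - σ) ^ (3 / 2 : ℝ)) * L ^ 57 := by gcongr

end Literature.NumberTheory.LFunctions

end
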